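import Literature.Barriers.RiemannHypothesis.TuranPartialSumsShiftEnclose
import Literature.Barriers.RiemannHypothesis.TuranPartialSumsShiftCheck
import HarnessLib

/-!
# Sections of `ζ` beyond `σ = 1`: the vertical-shift construction — soundness of the checker

Barrier catalogue `Literature/Barriers/RiemannHypothesis/`, companion of
`TuranPartialSumsShiftCheck.lean` (the executable checker) and `TuranPartialSumsShiftEnclose.lean`
(the analytic enclosures). Main result: `criterion_of_checkCell` — if `checkCell c = true` then for
every `N ≥ 360000` with `log N ∈ [c.n1/c.d, c.n2/c.d]` (`n2 = 0`: no upper end),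
`‖Bval N‖ < Rval N` and `2 ‖S(N/p)‖/p < Rval N` for every prime `p ∈ (√N, N]`, i.e. the two
hypotheses of `exists_zero_of_criterion` for the vertical-shift phases.

Every computed integer is related to the real quantity it bounds by an inclusion lemma
(`mem_…`, `…_spec`), bottom-up along the structure of the checker; the analytic input is exactly
`norm_Bval_le`, `Rval_ge` (`TuranPartialSumsShiftMain.lean`) and the checker-ready enclosures of
`TuranPartialSumsShiftEnclose.lean`.

## References

* R. E. Moore, *Interval Analysis* (1966), Ch. 3–4 (inclusion isotonicity). [folklore]
-/

noncomputable section

open Real Complex Set MeasureTheory intervalIntegral Finset Filter Topology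
open Literature.Analysis.ValidatedNumerics.NumericsMP
open Literature.Analysis.ValidatedNumerics (Numerics.cdiv Numerics.div_le_cdiv Numerics.fdiv_le_div
  Numerics.le_cdiv_mul_real Numerics.fdiv_mul_le_real)

namespace Literature.Barriers.RiemannHypothesis

namespace TuranShift

namespace Cert

/-! ## Arithmetic helpers -/

/-- [folklore] -/
theorem S_pos : 0 < S := by norm_num [S]

/-- [folklore] -/
theorem S_posR : (0 : ℝ) < S := by exact_mod_cast S_pos

/-- [folklore] -/
theorem S_neR : (S : ℝ) ≠ 0 := S_posR.ne'

/-- [folklore] -/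
theorem S_posZ : (0 : ℤ) < S := by exact_mod_cast S_pos

/-- [folklore] -/
theorem KU_pos : 0 < KU := by norm_num [KU]

/-- `x ≤ ⌈a/b⌉` from `x b ≤ a`. [folklore] -/
theorem le_cdiv_of_mul_le {x : ℝ} {a b : ℤ} (hb : 0 < b) (h : x * b ≤ a) :
    x ≤ (Numerics.cdiv a b : ℝ) := by
  have h1 := Numerics.le_cdiv_mul_real (a := a) hb
  have hb' : (0 : ℝ) < b := by exact_mod_cast hb
  exact le_of_mul_le_mul_right (h.trans h1) hb'

/-- `x ≤ ⌈a/b⌉` from `x ≤ a/b`. [folklore] -/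
theorem le_cdiv_of_le_div {x : ℝ} {a b : ℤ} (hb : 0 < b) (h : x ≤ (a : ℝ) / b) :
    x ≤ (Numerics.cdiv a b : ℝ) :=
  h.trans (Numerics.div_le_cdiv hb)

/-- `⌊a/b⌋ ≤ x` from `a ≤ x b`. [folklore] -/
theorem fdiv_le_of_le_mul {x : ℝ} {a b : ℤ} (hb : 0 < b) (h : (a : ℝ) ≤ x * b) :
    ((a / b : ℤ) : ℝ) ≤ x := by
  have h1 := Numerics.fdiv_mul_le_real (a := a) hb
  have hb' : (0 : ℝ) < b := by exact_mod_cast hb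
  exact le_of_mul_le_mul_right (h1.trans h) hb'

/-- Upper endpoint of a member. [folklore] -/
theorem le_hi_of_mem {x : ℝ} {I : MI} (h : MI.mem S x I) : x * S ≤ I.hi := h.2

/-- Lower endpoint of a member. [folklore] -/
theorem lo_le_of_mem {x : ℝ} {I : MI} (h : MI.mem S x I) : (I.lo : ℝ) ≤ x * S := h.1

/-- `x S ≤ max hi 0`. [folklore] -/
theorem le_maxhi_of_mem {x : ℝ} {I : MI} (h : MI.mem S x I) : x * S ≤ (max I.hi 0 : ℤ) := by
  have := h.2; push_cast; exact this.trans (le_max_left _ _)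

/-- Membership in `fracSpan`. [folklore] -/
theorem mem_fracSpan {p q p' q' : ℕ} (hq : 0 < q) (hq' : 0 < q') {x : ℝ}
    (h1 : (p : ℝ) / q ≤ x) (h2 : x ≤ (p' : ℝ) / q') : MI.mem S x (fracSpan p q p' q') := by
  have hqR : (0 : ℝ) < q := by exact_mod_cast hq
  have hqR' : (0 : ℝ) < q' := by exact_mod_cast hq'
  constructor
  · simp only [fracSpan]
    have h3 := Numerics.fdiv_le_div (a := (p : ℤ) * S) (b := q) (by exact_mod_cast hq)
    refine h3.trans ?_
    push_cast
    rw [div_le_iff₀ hqR]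
    rw [div_le_iff₀ hqR] at h1
    nlinarith [S_posR]
  · simp only [fracSpan]
    refine le_cdiv_of_le_div (by exact_mod_cast hq') ?_
    push_cast
    rw [le_div_iff₀ hqR']
    rw [le_div_iff₀ hqR'] at h2
    nlinarith [S_posR]

/-- The thin interval `⟨k, k⟩` contains `k/S`. [folklore] -/
theorem mem_thin (k : ℤ) : MI.mem S ((k : ℝ) / S) ⟨k, k⟩ := by
  constructor <;> simp [div_mul_cancel₀ _ S_neR]

/-- Hull, left. [folklore] -/
theorem mem_boxHull_left {z : ℂ} {A : MC} (h : MC.mem S z A) (B : MC) : MC.mem S z (boxHull A B) :=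
  ⟨MI.mem_hull_left h.1 _, MI.mem_hull_left h.2 _⟩

/-- Hull, right. [folklore] -/
theorem mem_boxHull_right {z : ℂ} {B : MC} (h : MC.mem S z B) (A : MC) : MC.mem S z (boxHull A B) :=
  ⟨MI.mem_hull_right h.1 _, MI.mem_hull_right h.2 _⟩

/-- **`normHi` bounds the norm**: `‖z‖ S ≤ normHi A` for `z ∈ A`. [folklore] -/
theorem norm_le_normHi {z : ℂ} {A : MC} (h : MC.mem S z A) : ‖z‖ * S ≤ (normHi A : ℝ) := by
  have hre := MI.abs_le_absHi h.1
  have him := MI.abs_le_absHi h.2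
  have h0re : (0 : ℤ) ≤ A.re.absHi := by
    unfold MI.absHi; exact le_trans (abs_nonneg _) (le_max_left _ _)
  have h0im : (0 : ℤ) ≤ A.im.absHi := by
    unfold MI.absHi; exact le_trans (abs_nonneg _) (le_max_left _ _)
  set a := A.re.absHi.natAbs with ha
  set b := A.im.absHi.natAbs with hb
  have hare : ((a : ℕ) : ℝ) = (A.re.absHi : ℝ) := by
    have : ((a : ℕ) : ℤ) = A.re.absHi := by rw [ha]; exact Int.natAbs_of_nonneg h0re
    exact_mod_cast this
  have hbim : ((b : ℕ) : ℝ) = (A.im.absHi : ℝ) := by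
    have : ((b : ℕ) : ℤ) = A.im.absHi := by rw [hb]; exact Int.natAbs_of_nonneg h0im
    exact_mod_cast this
  have hre' : |z.re| * S ≤ (a : ℝ) := by rw [hare]; exact hre
  have him' : |z.im| * S ≤ (b : ℝ) := by rw [hbim]; exact him
  set n := a ^ 2 + b ^ 2 with hn
  have hsq : (‖z‖ * S) ^ 2 ≤ (n : ℝ) := by
    have e : (‖z‖ * S) ^ 2 = (|z.re| * S) ^ 2 + (|z.im| * S) ^ 2 := by
      rw [mul_pow, mul_pow, mul_pow, sq_abs, sq_abs, ← add_mul, Complex.sq_norm, Complex.normSq_apply]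
      ring
    rw [e, hn]
    push_cast
    have h0 : 0 ≤ |z.re| * S := by positivity
    have h0' : 0 ≤ |z.im| * S := by positivity
    nlinarith
  have hlt : (n : ℝ) < ((Nat.sqrt n + 1 : ℕ) : ℝ) ^ 2 := by
    have := Nat.lt_succ_sqrt' n
    exact_mod_cast this
  have h0 : 0 ≤ ‖z‖ * S := by positivity
  have h3 : (‖z‖ * S) ^ 2 < ((Nat.sqrt n + 1 : ℕ) : ℝ) ^ 2 := lt_of_le_of_lt hsq hlt
  have h4 := lt_of_pow_lt_pow_left₀ 2 (by positivity) h3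
  unfold normHi
  rw [← hn]
  exact h4.le

/-- `absLo I ≤ |x| S` for `x ∈ I`. [folklore] -/
theorem absLo_le {x : ℝ} {I : MI} (h : MI.mem S x I) : (absLo I : ℝ) ≤ |x| * S := by
  unfold absLo
  split_ifs with hc
  · simp; positivity
  · rw [not_and_or, not_le, not_le] at hc
    rcases hc with hlo | hhi
    · have h1 : (I.lo : ℝ) ≤ x * S := h.1
      have hlo' : (0 : ℝ) < I.lo := by exact_mod_cast hlo
      have hxS : 0 < x * S := lt_of_lt_of_le hlo' h1
      rw [abs_of_pos (pos_of_mul_pos_left hxS S_posR.le)]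
      calc ((min I.lo.natAbs I.hi.natAbs : ℕ) : ℝ) ≤ (I.lo.natAbs : ℝ) := by
            exact_mod_cast min_le_left _ _
        _ = I.lo := by rw [Nat.cast_natAbs, Int.cast_abs, abs_of_pos hlo']
        _ ≤ x * S := h1
    · have h2 : x * S ≤ (I.hi : ℝ) := h.2
      have hhi' : (I.hi : ℝ) < 0 := by exact_mod_cast hhi
      have hxS : x * S < 0 := lt_of_le_of_lt h2 hhi'
      have hx : x < 0 := by
        by_contra hx
        exact absurd hxS (not_lt.2 (mul_nonneg (not_lt.1 hx) S_posR.le))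
      rw [abs_of_neg hx]
      calc ((min I.lo.natAbs I.hi.natAbs : ℕ) : ℝ) ≤ (I.hi.natAbs : ℝ) := by
            exact_mod_cast min_le_right _ _
        _ = -I.hi := by rw [Nat.cast_natAbs, Int.cast_abs, abs_of_neg hhi']
        _ ≤ -x * S := by linarith

/-- **`normLo` bounds the norm from below**: `normLo A ≤ ‖z‖ S` for `z ∈ A`. [folklore] -/
theorem normLo_le_norm {z : ℂ} {A : MC} (h : MC.mem S z A) : (normLo A : ℝ) ≤ ‖z‖ * S := by
  have hre := absLo_le h.1
  have him := absLo_le h.2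
  set a := absLo A.re
  set b := absLo A.im
  set n := a ^ 2 + b ^ 2 with hn
  have h1 : ((Nat.sqrt n : ℕ) : ℝ) ^ 2 ≤ n := by exact_mod_cast Nat.sqrt_le' n
  have h2 : (n : ℝ) ≤ (‖z‖ * S) ^ 2 := by
    have e : (‖z‖ * S) ^ 2 = (|z.re| * S) ^ 2 + (|z.im| * S) ^ 2 := by
      rw [mul_pow, mul_pow, mul_pow, sq_abs, sq_abs, ← add_mul, Complex.sq_norm, Complex.normSq_apply]
      ring
    rw [e, hn]; push_cast
    have ha0 : (0 : ℝ) ≤ a := Nat.cast_nonneg _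
    have hb0 : (0 : ℝ) ≤ b := Nat.cast_nonneg _
    nlinarith
  unfold normLo
  rw [← hn]
  exact (pow_le_pow_iff_left₀ (by positivity) (by positivity) two_ne_zero).1 (h1.trans h2)

/-! ## The phase enclosures -/

/-- `e^{−iθ} = conj (e^{iθ})`. [folklore] -/
theorem exp_neg_mul_I (θ : ℝ) :
    Complex.exp (-(θ : ℂ) * I) = starRingEnd ℂ (Complex.exp ((θ : ℂ) * I)) := by
  rw [← Complex.exp_conj, map_mul, Complex.conj_ofReal, Complex.conj_I]
  congr 1
  ring

/-- **`expNegI` encloses `e^{−iθ}`.** [folklore] -/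
theorem mem_expNegI {piI Θ : MI} (hpi : MI.mem S Real.pi piI) {E : MC} (h : expNegI piI Θ = some E)
    {θ : ℝ} (hθ : MI.mem S θ Θ) : MC.mem S (Complex.exp (-(θ : ℂ) * I)) E := by
  obtain ⟨E', hE', rfl⟩ := Option.map_eq_some_iff.1 h
  rw [exp_neg_mul_I]
  exact MC.mem_conj (MC.mem_expI S_pos hpi hE' hθ)

/-- The midpoint of `midRad` lies in the interval and the radius dominates the distance to it.
[folklore] -/
theorem midRad_spec {x : ℝ} {T : MI} (h : MI.mem S x T) :
    (T.lo ≤ (midRad T).1 ∧ (midRad T).1 ≤ T.hi) ∧ |x * S - (midRad T).1| ≤ ((midRad T).2 : ℝ) := by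
  have hlh : T.lo ≤ T.hi := MI.lo_le_hi h
  simp only [midRad]
  refine ⟨⟨by omega, by omega⟩, ?_⟩
  have h1 : (T.lo : ℝ) ≤ x * S := h.1
  have h2 : x * S ≤ (T.hi : ℝ) := h.2
  rw [abs_le]
  constructor
  · have : (((T.lo + T.hi) / 2 - T.lo : ℤ) : ℝ) ≤ ((max (T.hi - (T.lo + T.hi) / 2) ((T.lo + T.hi) / 2 - T.lo) : ℤ) : ℝ) := by
      exact_mod_cast le_max_right _ _
    push_cast at this ⊢
    linarith
  · have : ((T.hi - (T.lo + T.hi) / 2 : ℤ) : ℝ) ≤ ((max (T.hi - (T.lo + T.hi) / 2) ((T.lo + T.hi) / 2 - T.lo) : ℤ) : ℝ) := by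
      exact_mod_cast le_max_left _ _
    push_cast at this ⊢
    linarith

/-- `‖e^{−ia} − e^{−ib}‖ ≤ |a − b|`. [folklore] -/
theorem norm_expNeg_sub_le (a b : ℝ) :
    ‖Complex.exp (-(a : ℂ) * I) - Complex.exp (-(b : ℂ) * I)‖ ≤ |a - b| := by
  have h := Literature.Analysis.ValidatedNumerics.Numerics.CB.norm_exp_I_sub_exp_I_le (-a) (-b)
  have e1 : (((-a : ℝ)) : ℂ) * I = -(a : ℂ) * I := by push_cast; ring
  have e2 : (((-b : ℝ)) : ℂ) * I = -(b : ℂ) * I := by push_cast; ring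
  rw [e1, e2] at h
  refine h.trans (le_of_eq ?_)
  rw [show -a - -b = -(a - b) by ring, abs_neg]

/-- **`expNegIC` encloses `e^{−iθ}`** (centred form). [folklore] -/
theorem mem_expNegIC {piI Θ : MI} (hpi : MI.mem S Real.pi piI) {E : MC} (h : expNegIC piI Θ = some E)
    {θ : ℝ} (hθ : MI.mem S θ Θ) : MC.mem S (Complex.exp (-(θ : ℂ) * I)) E := by
  obtain ⟨E', hE', rfl⟩ := Option.map_eq_some_iff.1 h
  obtain ⟨_, hrad⟩ := midRad_spec hθ
  have h1 := mem_expNegI hpi hE' (mem_thin (midRad Θ).1)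
  refine MC.mem_widen h1 ?_
  refine le_trans (mul_le_mul_of_nonneg_right (norm_expNeg_sub_le _ _) S_posR.le) ?_
  have e : |θ - ((midRad Θ).1 : ℝ) / S| * S = |θ * S - (midRad Θ).1| := by
    rw [show θ * S - ((midRad Θ).1 : ℝ) = (θ - ((midRad Θ).1 : ℝ) / S) * S by rw [sub_mul, div_mul_cancel₀ _ S_neR], abs_mul,
      abs_of_pos S_posR]
  rw [e]
  exact hrad

/-! ## The power-sum boxes -/

/-- The summand `g(τ) = τ e^{−iτℓ}/k` and its derivative. [folklore] -/
theorem hasDerivAt_powTermFun (ℓ : ℝ) (k : ℕ) (t : ℝ) :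
    HasDerivAt (fun y : ℝ ↦ (y : ℂ) * Complex.exp (-((y * ℓ : ℝ) : ℂ) * I) * (((k : ℝ)⁻¹ : ℝ) : ℂ))
      ((1 * Complex.exp ((-(ℓ : ℂ) * I) * t) + (t : ℂ) * (Complex.exp ((-(ℓ : ℂ) * I) * t) * ((-(ℓ : ℂ) * I) * 1))) *
        (((k : ℝ)⁻¹ : ℝ) : ℂ)) t := by
  have hφ : HasDerivAt (fun y : ℝ ↦ Complex.exp ((-(ℓ : ℂ) * I) * (y : ℂ)))
      (Complex.exp ((-(ℓ : ℂ) * I) * t) * ((-(ℓ : ℂ) * I) * 1)) t := by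
    have h1 : HasDerivAt (fun y : ℝ ↦ (-(ℓ : ℂ) * I) * (y : ℂ)) ((-(ℓ : ℂ) * I) * 1) t :=
      (hasDerivAt_id t).ofReal_comp.const_mul _
    exact h1.cexp
  have hid : HasDerivAt (fun y : ℝ ↦ (y : ℂ)) 1 t := (hasDerivAt_id t).ofReal_comp
  have h2 := (hid.mul hφ).mul_const (((k : ℝ)⁻¹ : ℝ) : ℂ)
  refine h2.congr_of_eventuallyEq (Filter.Eventually.of_forall fun y ↦ ?_)
  have e : Complex.exp (-((y * ℓ : ℝ) : ℂ) * I) = Complex.exp ((-(ℓ : ℂ) * I) * (y : ℂ)) := by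
    congr 1; push_cast; ring
  simp only [Pi.mul_apply, e]

/-- The mean-value bound for the summand: for `0 ≤ τ, τ₀ ≤ τ₁`,
`‖g(τ) − g(τ₀)‖ ≤ |τ − τ₀| (1 + τ₁ ℓ)/k` (`ℓ ≥ 0`, `k ≥ 1`). [folklore] -/
theorem norm_powTermFun_sub_le {ℓ τ τ₀ τ₁ : ℝ} (hℓ : 0 ≤ ℓ) {k : ℕ} (hk : 1 ≤ k)
    (hτ : 0 ≤ τ) (hτ1 : τ ≤ τ₁) (hτ₀ : 0 ≤ τ₀) (hτ₀1 : τ₀ ≤ τ₁) :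
    ‖(τ : ℂ) * Complex.exp (-((τ * ℓ : ℝ) : ℂ) * I) * (((k : ℝ)⁻¹ : ℝ) : ℂ) -
        (τ₀ : ℂ) * Complex.exp (-((τ₀ * ℓ : ℝ) : ℂ) * I) * (((k : ℝ)⁻¹ : ℝ) : ℂ)‖ ≤
      (1 + τ₁ * ℓ) / k * |τ - τ₀| := by
  have hk0 : (0 : ℝ) < k := by exact_mod_cast hk
  set g : ℝ → ℂ := fun y ↦ (y : ℂ) * Complex.exp (-((y * ℓ : ℝ) : ℂ) * I) * (((k : ℝ)⁻¹ : ℝ) : ℂ) with hg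
  have hderiv : ∀ y ∈ Icc (0 : ℝ) τ₁, HasDerivWithinAt g
      ((1 * Complex.exp ((-(ℓ : ℂ) * I) * y) + (y : ℂ) * (Complex.exp ((-(ℓ : ℂ) * I) * y) * ((-(ℓ : ℂ) * I) * 1))) *
        (((k : ℝ)⁻¹ : ℝ) : ℂ)) (Icc (0 : ℝ) τ₁) y :=
    fun y _ ↦ (hasDerivAt_powTermFun ℓ k y).hasDerivWithinAt
  have hbound : ∀ y ∈ Icc (0 : ℝ) τ₁,
      ‖(1 * Complex.exp ((-(ℓ : ℂ) * I) * y) + (y : ℂ) * (Complex.exp ((-(ℓ : ℂ) * I) * y) * ((-(ℓ : ℂ) * I) * 1))) *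
        (((k : ℝ)⁻¹ : ℝ) : ℂ)‖ ≤ (1 + τ₁ * ℓ) / k := by
    intro y hy
    have he : ‖Complex.exp ((-(ℓ : ℂ) * I) * y)‖ = 1 := by
      rw [show (-(ℓ : ℂ) * I) * y = ((-(ℓ * y) : ℝ) : ℂ) * I by push_cast; ring, Complex.norm_exp_ofReal_mul_I]
    rw [norm_mul]
    have hk' : ‖(((k : ℝ)⁻¹ : ℝ) : ℂ)‖ = (k : ℝ)⁻¹ := by
      rw [Complex.norm_real, Real.norm_eq_abs, abs_of_pos (inv_pos.2 hk0)]
    rw [hk', div_eq_mul_inv]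
    refine mul_le_mul_of_nonneg_right ?_ (inv_pos.2 hk0).le
    refine (norm_add_le _ _).trans ?_
    simp only [norm_mul, norm_neg, one_mul, mul_one, Complex.norm_I, Complex.norm_real,
      Real.norm_eq_abs, he]
    rw [abs_of_nonneg hy.1, abs_of_nonneg hℓ]
    nlinarith [hy.2, hℓ]
  have h := Convex.norm_image_sub_le_of_norm_hasDerivWithin_le hderiv hbound (convex_Icc 0 τ₁)
    ⟨hτ₀, hτ₀1⟩ ⟨hτ, hτ1⟩
  simpa [hg, Real.norm_eq_abs] using h

/-- **`powTerm` encloses `τ e^{−iτ log k}/k`.** [folklore] -/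
theorem mem_powTerm {piI T : MI} (hpi : MI.mem S Real.pi piI) {τ : ℝ} (hT : MI.mem S τ T)
    (hT0 : 0 ≤ T.lo) {k : ℕ} (hk : 1 ≤ k) {B : MC} (h : powTerm piI T k = some B) :
    MC.mem S ((τ : ℂ) * Complex.exp (-((τ * Real.log k : ℝ) : ℂ) * I) * (((k : ℝ)⁻¹ : ℝ) : ℂ)) B := by
  unfold powTerm at h
  split at h
  · simp at h
  rename_i Lk hLk
  split at h
  · simp at h
  rename_i Em hEm
  simp only [Option.some.injEq] at h
  subst h
  have hk0 : (0 : ℝ) < k := by exact_mod_cast hk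
  have hlog := MI.mem_logNat S_pos hLk
  have hℓ0 : 0 ≤ Real.log k := Real.log_nonneg (by exact_mod_cast hk)
  obtain ⟨⟨hm1, hm2⟩, hrad⟩ := midRad_spec hT
  set mid := (midRad T).1 with hmid
  set rad := (midRad T).2 with hraddef
  set τ₀ : ℝ := (mid : ℝ) / S with hτ₀
  have hmidmem : MI.mem S τ₀ ⟨mid, mid⟩ := mem_thin mid
  -- the value at the midpoint
  have hE := mem_expNegI hpi hEm (MI.mem_mul S_pos hmidmem hlog)
  have hval : MC.mem S ((τ₀ : ℂ) * Complex.exp (-((τ₀ * Real.log k : ℝ) : ℂ) * I) * (((k : ℝ)⁻¹ : ℝ) : ℂ))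
      ((Em.mulMI S ⟨mid, mid⟩).divNat k) := by
    have h1 := MC.mem_divNat (MC.mem_mulMI S_pos hE hmidmem) hk
    convert h1 using 1
    push_cast
    field_simp
  refine MC.mem_widen hval ?_
  -- Lipschitz bound
  have hτlo : (T.lo : ℝ) ≤ τ * S := hT.1
  have hτhi : τ * S ≤ (T.hi : ℝ) := hT.2
  have hT0R : (0 : ℝ) ≤ T.lo := by exact_mod_cast hT0
  have hτ0 : 0 ≤ τ := by nlinarith [S_posR]
  set τ₁ : ℝ := (T.hi : ℝ) / S
  have hτ1 : τ ≤ τ₁ := by rw [le_div_iff₀ S_posR]; exact hτhi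
  have hτ₀0 : 0 ≤ τ₀ := by
    rw [hτ₀]; refine div_nonneg ?_ S_posR.le
    have : (T.lo : ℝ) ≤ mid := by exact_mod_cast hm1
    linarith
  have hτ₀1 : τ₀ ≤ τ₁ := by
    rw [hτ₀]; refine div_le_div_of_nonneg_right ?_ S_posR.le; exact_mod_cast hm2
  have hmv := norm_powTermFun_sub_le hℓ0 hk hτ0 hτ1 hτ₀0 hτ₀1
  refine le_trans (mul_le_mul_of_nonneg_right hmv S_posR.le) ?_
  -- `(1 + τ₁ ℓ)/k · |τ − τ₀| · S ≤ e`
  have hdist : |τ - τ₀| * S ≤ rad := by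
    have e : |τ - τ₀| * S = |τ * S - mid| := by
      rw [show τ * S - (mid : ℝ) = (τ - τ₀) * S by rw [hτ₀, sub_mul, div_mul_cancel₀ _ S_neR], abs_mul, abs_of_pos S_posR]
    rw [e]
    exact hrad
  have hrad0 : (0 : ℝ) ≤ rad := le_trans (by positivity) hdist
  have hlip : (1 + τ₁ * Real.log k) * S ≤ ((S + Numerics.cdiv (max T.hi 0 * max Lk.hi 0) S : ℤ) : ℝ) := by
    push_cast
    rw [add_mul, one_mul]
    refine add_le_add le_rfl ?_
    refine le_cdiv_of_mul_le S_posZ ?_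
    have h1 : (T.hi : ℝ) ≤ ((max T.hi 0 : ℤ) : ℝ) := by exact_mod_cast le_max_left _ _
    have h2 : Real.log k * S ≤ ((max Lk.hi 0 : ℤ) : ℝ) := le_maxhi_of_mem hlog
    have h3 : (0 : ℝ) ≤ ((max T.hi 0 : ℤ) : ℝ) := by exact_mod_cast le_max_right _ _
    have hThi0 : (0 : ℝ) ≤ T.hi := hT0R.trans (by exact_mod_cast le_trans hm1 hm2)
    calc τ₁ * Real.log k * S * S = T.hi * (Real.log k * S) := by
          simp only [τ₁]; field_simp
      _ ≤ ((max T.hi 0 : ℤ) : ℝ) * ((max Lk.hi 0 : ℤ) : ℝ) :=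
          mul_le_mul h1 h2 (mul_nonneg hℓ0 S_posR.le) h3
      _ = _ := by push_cast; ring
  set lip : ℤ := S + Numerics.cdiv (max T.hi 0 * max Lk.hi 0) S with hlipdef
  have hlip0 : (0 : ℝ) ≤ lip :=
    le_trans (mul_nonneg (by nlinarith [mul_nonneg (hτ₀0.trans hτ₀1) hℓ0]) S_posR.le) hlip
  refine le_cdiv_of_mul_le (by exact_mod_cast hk) ?_
  refine le_cdiv_of_mul_le S_posZ ?_
  push_cast
  calc (1 + τ₁ * Real.log k) / k * |τ - τ₀| * S * k * S
      = ((1 + τ₁ * Real.log k) * S) * (|τ - τ₀| * S) := by field_simp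
    _ ≤ (lip : ℝ) * rad := mul_le_mul hlip hdist (by positivity) hlip0
    _ = rad * lip := by ring

/-- **`powPhase` encloses `e^{−iτ log k}`.** [folklore] -/
theorem mem_powPhase {piI T : MI} (hpi : MI.mem S Real.pi piI) {τ : ℝ} (hT : MI.mem S τ T)
    {k : ℕ} (hk : 1 ≤ k) {B : MC} (h : powPhase piI T k = some B) :
    MC.mem S (Complex.exp (-((τ * Real.log k : ℝ) : ℂ) * I)) B := by
  unfold powPhase at h
  split at h
  · simp at h
  rename_i Lk hLk
  split at h
  · simp at h
  rename_i Em hEm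
  simp only [Option.some.injEq] at h
  subst h
  have hlog := MI.mem_logNat S_pos hLk
  have hℓ0 : 0 ≤ Real.log k := Real.log_nonneg (by exact_mod_cast hk)
  obtain ⟨_, hrad⟩ := midRad_spec hT
  set mid := (midRad T).1
  set rad := (midRad T).2
  have hE := mem_expNegI hpi hEm (MI.mem_mul S_pos (mem_thin mid) hlog)
  refine MC.mem_widen hE ?_
  refine le_trans (mul_le_mul_of_nonneg_right (norm_expNeg_sub_le _ _) S_posR.le) ?_
  refine le_cdiv_of_mul_le S_posZ ?_
  have hdist : |τ * S - mid| ≤ (rad : ℝ) := hrad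
  have h2 : Real.log k * S ≤ ((max Lk.hi 0 : ℤ) : ℝ) := le_maxhi_of_mem hlog
  have e : |τ * Real.log k - (mid : ℝ) / S * Real.log k| * S * S = |τ * S - mid| * (Real.log k * S) := by
    rw [show τ * Real.log k - (mid : ℝ) / S * Real.log k = (τ - (mid : ℝ) / S) * Real.log k by ring,
      abs_mul, abs_of_nonneg hℓ0,
      show τ * S - (mid : ℝ) = (τ - (mid : ℝ) / S) * S by rw [sub_mul, div_mul_cancel₀ _ S_neR], abs_mul, abs_of_pos S_posR]
    ring
  push_cast
  rw [e]
  calc |τ * S - mid| * (Real.log k * S) ≤ (rad : ℝ) * ((max Lk.hi 0 : ℤ) : ℝ) :=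
        mul_le_mul hdist h2 (mul_nonneg hℓ0 S_posR.le) (le_trans (abs_nonneg _) hdist)
    _ = _ := by push_cast; ring

/-- **`powSums` encloses `τ S(n)`.** [folklore] -/
theorem mem_powSums {piI T : MI} (hpi : MI.mem S Real.pi piI) {τ : ℝ} (hT : MI.mem S τ T)
    (hT0 : 0 ≤ T.lo) : ∀ (n : ℕ) {A : MC}, powSums piI T n = some A →
      MC.mem S ((τ : ℂ) * powSum (1 + τ * I) n) A := by
  intro n
  induction n with
  | zero =>
    intro A h
    simp only [powSums, Option.some.injEq] at h
    subst h
    have : (τ : ℂ) * powSum (1 + τ * I) 0 = ((0 : ℤ) : ℂ) := by simp [powSum]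
    rw [this]; exact MC.mem_ofInt S 0
  | succ n ih =>
    intro A h
    simp only [powSums] at h
    split at h
    · rename_i acc t hacc ht
      simp only [Option.some.injEq] at h
      subst h
      have h1 := ih hacc
      have h2 := mem_powTerm hpi hT hT0 (by omega : 1 ≤ n + 1) ht
      have e : (τ : ℂ) * powSum (1 + τ * I) (n + 1) = (τ : ℂ) * powSum (1 + τ * I) n +
          (τ : ℂ) * Complex.exp (-((τ * Real.log (n + 1 : ℕ) : ℝ) : ℂ) * I) * ((((n + 1 : ℕ) : ℝ)⁻¹ : ℝ) : ℂ) := by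
        rw [tau_mul_powSum_eq_sum, tau_mul_powSum_eq_sum, Finset.sum_Icc_succ_top (by omega)]
      rw [e]
      exact MC.mem_add h1 h2
    · simp at h

/-- **`splitHull` preserves inclusion.** [folklore] -/
theorem mem_splitHull {f : MI → Option MC} {z : ℂ} {x : ℝ}
    (hf : ∀ (T : MI) (B : MC), 0 ≤ T.lo → MI.mem S x T → f T = some B → MC.mem S z B) :
    ∀ (n : ℕ) (T : MI) (B : MC), 0 ≤ T.lo → MI.mem S x T → splitHull f n T = some B → MC.mem S z B := by
  intro n
  induction n with
  | zero => intro T B hT0 hx h; exact hf T B hT0 hx h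
  | succ n ih =>
    intro T B hT0 hx h
    simp only [splitHull] at h
    split at h
    · rename_i A B' hA hB'
      simp only [Option.some.injEq] at h
      subst h
      have hlh : T.lo ≤ T.hi := MI.lo_le_hi hx
      have hm1 : T.lo ≤ (T.lo + T.hi) / 2 := by omega
      rcases le_total (x * S) (((T.lo + T.hi) / 2 : ℤ) : ℝ) with hle | hge
      · exact mem_boxHull_left (ih ⟨T.lo, (T.lo + T.hi) / 2⟩ _ hT0 ⟨hx.1, hle⟩ hA) _
      · exact mem_boxHull_right (ih ⟨(T.lo + T.hi) / 2, T.hi⟩ _ (le_trans hT0 hm1) ⟨hge, hx.2⟩ hB') _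
    · simp at h

/-- **`d0Box` encloses `τ c₀`.** [folklore] -/
theorem mem_d0Box {N : ℕ} (hN : 360000 ≤ N) {piI T : MI} (hpi : MI.mem S Real.pi piI)
    (hT : MI.mem S (tauN N) T) (hT0 : 0 ≤ T.lo) {D : MC} (h : d0Box piI T = some D) :
    MC.mem S ((tauN N : ℂ) * emConst (sN N)) D := by
  unfold d0Box at h
  split at h
  · rename_i A E hA hE
    simp only [Option.some.injEq] at h
    subst h
    have hτ := tauN_pos hN
    have h1 := mem_powSums hpi hT hT0 KC hA
    have h2 := mem_powPhase hpi hT (by norm_num [KC]) hE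
    rw [← sN_def] at h1
    have h30 : ((KC : ℕ) : ℝ) = 30 := by norm_num [KC]
    rw [h30] at h2
    have hpint : MC.mem S ((1 - Complex.exp (-((tauN N * Real.log 30 : ℝ) : ℂ) * I)) * (-I))
        (((MC.ofInt S 1).sub E).mulNegI) := by
      have := MC.mem_mulNegI (MC.mem_sub (MC.mem_ofInt S 1) h2)
      simpa using this
    have hlast : MC.mem S ((tauN N : ℂ) * Complex.exp (-((tauN N * Real.log 30 : ℝ) : ℂ) * I) * (((1 / 60 : ℝ)) : ℂ))
        ((E.mulMI S T).divNat (2 * KC)) := by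
      have := MC.mem_divNat (MC.mem_mulMI S_pos h2 hT) (by norm_num [KC] : 0 < 2 * KC)
      convert this using 1
      push_cast
      norm_num [KC]
      ring
    have hexpr := MC.mem_sub (MC.mem_sub h1 hpint) hlast
    have hK : powSum (sN N) KC = powSum (sN N) 30 := by norm_num [KC]
    rw [hK] at hexpr
    refine MC.mem_widen hexpr ?_
    have hb := norm_tau_emConst_sub_le hN
    have h8 := norm_sN_mul_le hN
    refine le_cdiv_of_mul_le (by norm_num) ?_
    have hth : tauN N * S ≤ ((max T.hi 0 : ℤ) : ℝ) := le_maxhi_of_mem hT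
    calc ‖(tauN N : ℂ) * emConst (sN N) - ((tauN N : ℂ) * powSum (sN N) 30 -
          (1 - Complex.exp (-((tauN N * Real.log 30 : ℝ) : ℂ) * I)) * (-I) -
          (tauN N : ℂ) * Complex.exp (-((tauN N * Real.log 30 : ℝ) : ℂ) * I) * (((1 / 60 : ℝ)) : ℂ))‖ * S * 1800
        ≤ tauN N * (‖sN N * (sN N + 1)‖ / 14400) * S * 1800 := by gcongr
      _ ≤ tauN N * (8 / 14400) * S * 1800 := by gcongr
      _ = tauN N * S := by ring
      _ ≤ _ := hth
  · simp at h

/-- **The list of small-block boxes**: length and inclusion. [folklore] -/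
theorem tSList_spec {piI T : MI} (hpi : MI.mem S Real.pi piI) (hT0 : 0 ≤ T.lo) :
    ∀ (n : ℕ) {l : List MC}, tSList piI T n = some l →
      l.length = n ∧ ∀ (m : ℕ) (B : MC), l[m]? = some B →
        ∀ τ : ℝ, MI.mem S τ T → MC.mem S ((τ : ℂ) * powSum (1 + τ * I) m) B := by
  intro n
  induction n with
  | zero =>
    intro l h
    simp only [tSList, Option.some.injEq] at h
    subst h
    simp
  | succ n ih =>
    intro l h
    simp only [tSList] at h
    split at h
    · rename_i l' b hl' hb
      simp only [Option.some.injEq] at h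
      subst h
      obtain ⟨hlen, hmem⟩ := ih hl'
      refine ⟨by simp [hlen], ?_⟩
      intro m B hmB τ hτ
      rcases Nat.lt_or_ge m n with hm | hm
      · rw [List.getElem?_append_left (by rw [hlen]; exact hm)] at hmB
        exact hmem m B hmB τ hτ
      · rw [List.getElem?_append_right (by rw [hlen]; exact hm)] at hmB
        have hmn : m = n := by
          have : (([b] : List MC)[m - l'.length]?).isSome := by rw [hmB]; rfl
          simp at this
          omega
        subst hmn
        simp [hlen] at hmB
        subst hmB
        exact mem_splitHull (fun T' B' hT0' hx hf ↦ mem_powSums hpi hx hT0' m hf) DEPTHS T _ hT0 hτ hb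
    · simp at h

/-- **`listHull` contains every listed box in range.** [folklore] -/
theorem listHull_mem {l : List MC} {mlo : ℕ} {z : ℂ} :
    ∀ (k : ℕ) {H : MC}, listHull l mlo k = some H → ∀ {m : ℕ}, mlo ≤ m → m ≤ k →
      ∀ {B : MC}, l[m]? = some B → MC.mem S z B → MC.mem S z H := by
  intro k
  induction k with
  | zero =>
    intro H h m hm1 hm2 B hB hz
    simp only [listHull] at h
    split_ifs at h with h0
    have hm0 : m = 0 := by omega
    subst hm0
    rw [hB] at h; simp at h; subst h; exact hz
  | succ k ih =>
    intro H h m hm1 hm2 B hB hz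
    simp only [listHull] at h
    split_ifs at h with h1 h2
    · have hmk : m = k + 1 := by omega
      subst hmk
      rw [hB] at h; simp at h; subst h; exact hz
    · split at h
      · rename_i H' B' hH' hB'
        simp only [Option.some.injEq] at h
        subst h
        rcases Nat.lt_or_ge m (k + 1) with hm | hm
        · exact mem_boxHull_left (ih hH' hm1 (by omega) hB hz) _
        · have hmk : m = k + 1 := by omega
          subst hmk
          rw [hB] at hB'; simp at hB'; subst hB'
          exact mem_boxHull_right hz _
      · simp at h

/-! ## The envelope ratio bound -/

/-- `e^{16} ≤ Z = 8886113`. [folklore] -/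
theorem exp_sixteen_le_thetaZ : Real.exp 16 ≤ thetaZ := by
  have h1 : Real.exp 16 = Real.exp 1 ^ 16 := by rw [← Real.exp_nat_mul]; norm_num
  rw [h1, thetaZ]
  calc Real.exp 1 ^ 16 ≤ (2.7182818286 : ℝ) ^ 16 :=
        pow_le_pow_left₀ (Real.exp_pos 1).le Real.exp_one_lt_d9.le 16
    _ ≤ 8886113 := by norm_num

/-- `Z ≤ e^{16.001}`. [folklore] -/
theorem thetaZ_le_exp : thetaZ ≤ Real.exp 16.001 := by
  have hZ : (0 : ℝ) < thetaZ := by norm_num [thetaZ]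
  calc thetaZ = Real.exp (Real.log thetaZ) := (Real.exp_log hZ).symm
    _ ≤ Real.exp 16.001 := Real.exp_le_exp.2 log_thetaZ_le'

/-- `c16001 ≥ 16.001 S`, `c0864 ≥ 0.0864 S`, `c0722 ≥ 0.0722 S`. [folklore] -/
theorem consts_ge : (16.001 : ℝ) * S ≤ c16001 ∧ (0.0864 : ℝ) * S ≤ c0864 ∧ (0.0722 : ℝ) * S ≤ c0722 := by
  refine ⟨?_, ?_, ?_⟩
  · refine le_cdiv_of_mul_le (by norm_num) ?_; push_cast; exact le_of_eq (by ring)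
  · refine le_cdiv_of_mul_le (by norm_num) ?_; push_cast; exact le_of_eq (by ring)
  · refine le_cdiv_of_mul_le (by norm_num) ?_; push_cast; exact le_of_eq (by ring)

/-- **`expNegHalfHi` bounds `e^{−v/2}` from above.** [folklore] -/
theorem expNegHalfHi_spec {V : MI} {e : ℤ} (h : expNegHalfHi V = some e) {v : ℝ} (hv : MI.mem S v V) :
    Real.exp (-(v / 2)) * S ≤ e := by
  obtain ⟨Y, hY, rfl⟩ := Option.map_eq_some_iff.1 h
  have hv2 := MI.mem_divNat hv (by norm_num : 0 < 2)
  unfold halfCap at hY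
  split_ifs at hY with hc
  · set l := (V.divNat 2).lo
    have hl : (l : ℝ) ≤ v / 2 * S := hv2.1
    have hmem : MI.mem S ((l : ℝ) / S) (MI.lower (V.divNat 2)) := MI.mem_lower S_pos _
    have h1 := MI.mem_exp S_pos hY (MI.mem_neg hmem)
    refine le_trans ?_ h1.2
    refine mul_le_mul_of_nonneg_right (Real.exp_le_exp.2 ?_) S_posR.le
    rw [neg_le_neg_iff, div_le_iff₀ S_posR]; exact hl
  · rw [not_le] at hc
    have h1 := MI.mem_exp S_pos hY (MI.mem_neg (MI.mem_ofInt S 60))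
    refine le_trans ?_ h1.2
    refine mul_le_mul_of_nonneg_right (Real.exp_le_exp.2 ?_) S_posR.le
    have hl : (((V.divNat 2).lo : ℤ) : ℝ) ≤ v / 2 * S := hv2.1
    have hc' : (60 : ℝ) * S < ((V.divNat 2).lo : ℝ) := by exact_mod_cast hc
    push_cast
    nlinarith [S_posR]

/-- **`tableI` encloses `v² e^{−v/2}/(8π)`.** [folklore] -/
theorem mem_tableI {piI V : MI} (hpi : MI.mem S Real.pi piI) {Q : MI} (h : tableI piI V = some Q)
    {v : ℝ} (hv : MI.mem S v V) : MI.mem S (v ^ 2 * Real.exp (-(v / 2)) / (8 * Real.pi)) Q := by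
  unfold tableI at h
  split at h
  · simp at h
  rename_i e he
  have h1 := expNegHalfHi_spec he hv
  have hexp : MI.mem S (Real.exp (-(v / 2))) ⟨0, e⟩ := ⟨by push_cast; positivity, h1⟩
  have h2 := MI.mem_mul S_pos (MI.mem_sqr S_pos hv) hexp
  have h3 := MI.mem_divPos S_pos h h2 (MI.mem_mulInt hpi 8)
  convert h3 using 1
  push_cast; ring

/-- **`sylvHi` bounds `0.0722 + (10 + 2v) e^{−v/2}` from above.** [folklore] -/
theorem sylvHi_spec {V : MI} {z : ℤ} (h : sylvHi V = some z) {v : ℝ} (hv : MI.mem S v V) :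
    (0.0722 + (10 + 2 * v) * Real.exp (-(v / 2))) * S ≤ z := by
  unfold sylvHi at h
  split at h
  · simp at h
  rename_i e he
  simp only [Option.some.injEq] at h
  subst h
  have h1 := expNegHalfHi_spec he hv
  have hexp : MI.mem S (Real.exp (-(v / 2))) ⟨0, e⟩ := ⟨by push_cast; positivity, h1⟩
  have h2 := MI.mem_mul S_pos (MI.mem_add (MI.mem_ofInt S 10) (MI.mem_mulInt hv 2)) hexp
  have h3 : (10 + v * ((2 : ℤ) : ℝ)) * Real.exp (-(v / 2)) * S ≤
      ((((MI.ofInt S 10).add (V.mulInt 2)).mul S ⟨0, e⟩).hi : ℝ) := by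
    have := h2.2; push_cast at this ⊢; exact this
  push_cast
  rw [add_mul]
  refine add_le_add consts_ge.2.2 ?_
  calc (10 + 2 * v) * Real.exp (-(v / 2)) * S = (10 + v * ((2 : ℤ) : ℝ)) * Real.exp (-(v / 2)) * S := by
        push_cast; ring
    _ ≤ _ := h3

/-- **The envelope ratio bound is sound**: for `v ∈ V`, `v ≥ 4`, `t ≥ e^v` (and `t ≤ Z` if `belowZ`),
`thetaEnv(t)/t · S ≤ etaHat`. [folklore] -/
theorem etaHat_spec {piI V : MI} (hpi : MI.mem S Real.pi piI) {bz : Bool} {η : ℤ}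
    (h : etaHat piI V bz = some η) {v : ℝ} (hv : MI.mem S v V) (hv4 : 4 ≤ v) {t : ℝ}
    (ht : Real.exp v ≤ t) (hZ : bz = true → t ≤ thetaZ) : thetaEnv t / t * S ≤ η := by
  have ha : Real.exp 4 ≤ Real.exp v := Real.exp_le_exp.2 hv4
  unfold etaHat at h
  split_ifs at h with hbz h16
  · obtain ⟨Q, hQ, rfl⟩ := Option.map_eq_some_iff.1 h
    have h1 := thetaEnv_div_le_table ha ht (hZ hbz)
    rw [tableEnv_exp_div] at h1
    exact le_trans (mul_le_mul_of_nonneg_right h1 S_posR.le) (mem_tableI hpi hQ hv).2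
  · have hv16 : 16.001 < v := by
      have h1 := consts_ge.1
      have h2 : ((c16001 : ℤ) : ℝ) < V.lo := by exact_mod_cast h16
      have h3 : (V.lo : ℝ) ≤ v * S := hv.1
      nlinarith [S_posR]
    have hZa : thetaZ < Real.exp v := lt_of_le_of_lt thetaZ_le_exp (Real.exp_lt_exp.2 hv16)
    have h1 := thetaEnv_div_le_sylv hZa ht
    rw [sylvEnv_exp_div] at h1
    exact le_trans (mul_le_mul_of_nonneg_right h1 S_posR.le) (sylvHi_spec h hv)
  · obtain ⟨Q, hQ, rfl⟩ := Option.map_eq_some_iff.1 h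
    have h1 := thetaEnv_div_le_max ha ht
    rw [tableEnv_exp_div] at h1
    have h2 := (mem_tableI hpi hQ hv).2
    have h3 := consts_ge.2.1
    refine le_trans (mul_le_mul_of_nonneg_right h1 S_posR.le) ?_
    rcases le_total (v ^ 2 * Real.exp (-(v / 2)) / (8 * Real.pi)) 0.0864 with hle | hge
    · rw [max_eq_right hle]
      exact h3.trans (by exact_mod_cast le_max_right _ _)
    · rw [max_eq_left hge]
      exact h2.trans (by exact_mod_cast le_max_left _ _)

/-! ## The cell and its `τ`-interval -/

/-- Unpacking `Cell.ok`. [folklore] -/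
theorem ok_spec {c : Cell} (hok : c.ok = true) :
    0 < c.d ∧ 25 * c.d ≤ 2 * c.n1 ∧ (c.n2 = 0 ∨ c.n1 ≤ c.n2) := by
  simpa [Cell.ok] using hok

/-- [folklore] -/
theorem KU_posR : (0 : ℝ) < KU := by norm_num [KU]

/-- [folklore] -/
theorem twoKU_posR : (0 : ℝ) < ((2 * KU : ℕ) : ℝ) := by norm_num [KU]

/-- Left endpoint of the `j`-th `u`-subcell: `a_j = (KU + j)/(2 KU)` (so `b_j = a_{j+1}`). [folklore] -/
def ua (j : ℕ) : ℝ := ((KU + j : ℕ) : ℝ) / ((2 * KU : ℕ) : ℝ)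

/-- `a_0 = ½`. [folklore] -/
theorem ua_zero : ua 0 = 1 / 2 := by norm_num [ua, KU]

/-- `a_{KU} = 1`. [folklore] -/
theorem ua_KU : ua KU = 1 := by norm_num [ua, KU]

/-- `½ ≤ a_j`. [folklore] -/
theorem half_le_ua (j : ℕ) : 1 / 2 ≤ ua j := by
  unfold ua
  rw [div_le_div_iff₀ (by norm_num) twoKU_posR]; push_cast; nlinarith [KU_posR]

/-- `a_j ≤ 1` for `j ≤ KU`. [folklore] -/
theorem ua_le_one {j : ℕ} (hj : j ≤ KU) : ua j ≤ 1 := by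
  unfold ua
  rw [div_le_one twoKU_posR]; exact_mod_cast (by omega : KU + j ≤ 2 * KU)

/-- `a_{j+1} − a_j = 1/(2 KU)`. [folklore] -/
theorem ua_succ_sub (j : ℕ) : ua (j + 1) - ua j = 1 / ((2 * KU : ℕ) : ℝ) := by
  unfold ua
  rw [div_sub_div_same]
  congr 1
  push_cast; ring

/-- [folklore] -/
theorem ua_lt_succ (j : ℕ) : ua j < ua (j + 1) := by
  have h := ua_succ_sub j
  have : (0 : ℝ) < 1 / ((2 * KU : ℕ) : ℝ) := div_pos one_pos twoKU_posR
  linarith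

/-- [folklore] -/
theorem ua_pos (j : ℕ) : 0 < ua j := lt_of_lt_of_le (by norm_num) (half_le_ua j)

/-- [folklore] -/
theorem ua_mono {i j : ℕ} (h : i ≤ j) : ua i ≤ ua j := by
  unfold ua
  exact div_le_div_of_nonneg_right (by exact_mod_cast (by omega : KU + i ≤ KU + j)) twoKU_posR.le

section CellFacts

variable {c : Cell} {N : ℕ}

/-- `d > 0`. [folklore] -/
theorem d_pos (hok : c.ok = true) : (0 : ℝ) < c.d := by exact_mod_cast (ok_spec hok).1

/-- `d > 0` in `ℕ`. [folklore] -/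
theorem d_posN (hok : c.ok = true) : 0 < c.d := (ok_spec hok).1

/-- `n1 > 0`. [folklore] -/
theorem n1_posN (hok : c.ok = true) : 0 < c.n1 := by
  have := (ok_spec hok).2.1; have := (ok_spec hok).1; omega

/-- `n1 > 0`. [folklore] -/
theorem n1_pos (hok : c.ok = true) : (0 : ℝ) < c.n1 := by exact_mod_cast n1_posN hok

/-- `12.5 ≤ L1`. [folklore] -/
theorem L1_ge (hok : c.ok = true) : (25 : ℝ) / 2 ≤ c.n1 / c.d := by
  rw [div_le_div_iff₀ (by norm_num) (d_pos hok)]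
  have h := (ok_spec hok).2.1
  have : ((25 * c.d : ℕ) : ℝ) ≤ ((2 * c.n1 : ℕ) : ℝ) := by exact_mod_cast h
  push_cast at this; linarith

/-- `L1 ≤ L`. [folklore] -/
theorem L1_le (hok : c.ok = true) (hL1 : (c.n1 : ℝ) ≤ c.d * Real.log N) : (c.n1 : ℝ) / c.d ≤ Real.log N := by
  rw [div_le_iff₀ (d_pos hok)]; linarith

/-- `12.5 ≤ L`. [folklore] -/
theorem L_ge (hok : c.ok = true) (hL1 : (c.n1 : ℝ) ≤ c.d * Real.log N) : (25 : ℝ) / 2 ≤ Real.log N :=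
  (L1_ge hok).trans (L1_le hok hL1)

/-- `0 < L`. [folklore] -/
theorem L_pos (hok : c.ok = true) (hL1 : (c.n1 : ℝ) ≤ c.d * Real.log N) : 0 < Real.log N :=
  lt_of_lt_of_le (by norm_num) (L_ge hok hL1)

/-- `w = 1/L ≤ w2 = d/n1`. [folklore] -/
theorem w_le (hok : c.ok = true) (hL1 : (c.n1 : ℝ) ≤ c.d * Real.log N) :
    1 / Real.log N ≤ (c.d : ℝ) / c.n1 := by
  rw [div_le_div_iff₀ (L_pos hok hL1) (n1_pos hok)]; linarith

/-- `L ≤ L2` when `n2 ≠ 0`. [folklore] -/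
theorem L_le_L2 (hok : c.ok = true) (hL2 : c.n2 ≠ 0 → (c.d : ℝ) * Real.log N ≤ c.n2) (hn2 : c.n2 ≠ 0) :
    Real.log N ≤ (c.n2 : ℝ) / c.d := by
  rw [le_div_iff₀ (d_pos hok)]; have := hL2 hn2; linarith

/-- `τ ≤ 29 d/(4 n1)`. [folklore] -/
theorem tau_le (hok : c.ok = true) (hL1 : (c.n1 : ℝ) ≤ c.d * Real.log N) :
    tauN N ≤ 29 * c.d / (4 * c.n1) := by
  unfold tauN shiftX
  have h := w_le hok hL1
  have hn := n1_pos hok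
  calc 29 / 4 / Real.log N = 29 / 4 * (1 / Real.log N) := by ring
    _ ≤ 29 / 4 * (c.d / c.n1) := mul_le_mul_of_nonneg_left h (by norm_num)
    _ = _ := by field_simp

/-- `0 < τ`. [folklore] -/
theorem tau_pos' (hok : c.ok = true) (hL1 : (c.n1 : ℝ) ≤ c.d * Real.log N) : 0 < tauN N := by
  unfold tauN shiftX; exact div_pos (by norm_num) (L_pos hok hL1)

/-- **`τ ∈ tauI c`.** [folklore] -/
theorem mem_tauI (hok : c.ok = true) (hL1 : (c.n1 : ℝ) ≤ c.d * Real.log N)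
    (hL2 : c.n2 ≠ 0 → (c.d : ℝ) * Real.log N ≤ c.n2) : MI.mem S (tauN N) (tauI c) := by
  have hτ := tau_pos' hok hL1
  have hd := d_pos hok
  have hn := n1_pos hok
  have hL := L_pos hok hL1
  constructor
  · simp only [tauI]
    split_ifs with h0
    · push_cast; positivity
    · have h2 := hL2 h0
      have hn2N : 0 < c.n2 := Nat.pos_of_ne_zero h0
      have hn2 : (0 : ℝ) < c.n2 := by exact_mod_cast hn2N
      refine fdiv_le_of_le_mul (by exact_mod_cast (show 0 < 4 * c.n2 by omega)) ?_
      have key : 29 * (c.d : ℝ) ≤ tauN N * (4 * c.n2) := by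
        unfold tauN shiftX
        rw [div_mul_eq_mul_div, le_div_iff₀ hL]
        nlinarith
      push_cast
      nlinarith [S_posR, key]
  · simp only [tauI]
    refine le_cdiv_of_le_div (by have := n1_posN hok; exact_mod_cast (show 0 < 4 * c.n1 by omega)) ?_
    push_cast
    rw [le_div_iff₀ (by positivity)]
    have h := tau_le hok hL1
    rw [le_div_iff₀ (by positivity)] at h
    nlinarith [S_posR]

/-- `0 ≤ (tauI c).lo`. [folklore] -/
theorem tauI_lo_nonneg (c : Cell) : 0 ≤ (tauI c).lo := by
  simp only [tauI]
  split_ifs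
  · exact le_rfl
  · exact Int.ediv_nonneg (by positivity) (by positivity)

end CellFacts

/-! ## The `u`-subcells: index bounds and the block box -/

section USub

variable {c : Cell} {N : ℕ}

/-- On the `j`-th subcell (`j < KU`): `½ ≤ u ≤ 1`. [folklore] -/
theorem u_bounds {j : ℕ} (hj : j < KU) {u : ℝ} (hu : u ∈ Icc (ua j) (ua (j + 1))) :
    1 / 2 ≤ u ∧ u ≤ 1 :=
  ⟨(half_le_ua j).trans hu.1, hu.2.trans (ua_le_one (by omega))⟩

/-- `e^{14} ≥ 1202600`. [folklore] -/
theorem exp_fourteen_ge : (1202600 : ℝ) ≤ Real.exp 14 := by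
  have h1 : Real.exp 14 = Real.exp 1 ^ 14 := by rw [← Real.exp_nat_mul]; norm_num
  rw [h1]
  calc (1202600 : ℝ) ≤ (2.7182818283 : ℝ) ^ 14 := by norm_num
    _ ≤ Real.exp 1 ^ 14 := pow_le_pow_left₀ (by norm_num) Real.exp_one_gt_d9.le 14

/-- The lower `q`-bound on the subcell: `e^{(1 − b_j) L1} ≤ q = N^{1−u}`. [folklore] -/
theorem exp_logq_lo_le (hok : c.ok = true) (hL1 : (c.n1 : ℝ) ≤ c.d * Real.log N)
    {j : ℕ} (hj : j < KU) {u : ℝ} (hu : u ∈ Icc (ua j) (ua (j + 1))) :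
    Real.exp ((((2 * KU - (KU + j + 1)) * c.n1 : ℕ) : ℝ) / ((2 * KU * c.d : ℕ) : ℝ)) ≤
      Real.exp ((1 - u) * Real.log N) := by
  refine Real.exp_le_exp.2 ?_
  have hL := L_pos hok hL1
  have hL1' := L1_le hok hL1
  have hd := d_pos hok
  have hb : u ≤ ua (j + 1) := hu.2
  have hb1 : ua (j + 1) ≤ 1 := ua_le_one (by omega)
  have e : (((2 * KU - (KU + j + 1)) * c.n1 : ℕ) : ℝ) / ((2 * KU * c.d : ℕ) : ℝ) =
      (1 - ua (j + 1)) * (c.n1 / c.d) := by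
    unfold ua
    have hsub : ((2 * KU - (KU + j + 1) : ℕ) : ℝ) = 2 * KU - (KU + j + 1) := by
      rw [Nat.cast_sub (by omega : KU + j + 1 ≤ 2 * KU)]; push_cast; ring
    have hK := KU_posR
    push_cast [hsub]
    field_simp
    ring
  rw [e]
  calc (1 - ua (j + 1)) * (c.n1 / c.d) ≤ (1 - ua (j + 1)) * Real.log N :=
        mul_le_mul_of_nonneg_left hL1' (by linarith)
    _ ≤ (1 - u) * Real.log N := mul_le_mul_of_nonneg_right (by linarith) hL.le

/-- `t/(t+1) ≥ 600/601` on the subcell. [folklore] -/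
theorem t_ratio_ge (hN : 360000 ≤ N) {u : ℝ} (hu0 : 1 / 2 ≤ u) :
    (600 : ℝ) / 601 ≤ Real.exp (u * Real.log N) / (Real.exp (u * Real.log N) + 1) := by
  have ht := exp_ge hN hu0
  have ht0 := Real.exp_pos (u * Real.log N)
  rw [div_le_div_iff₀ (by norm_num) (by positivity)]
  nlinarith

/-- **`mLo` is a valid lower index bound** for both the ceiling and the floor block index.
[folklore] -/
theorem mLo_spec (hN : 360000 ≤ N) (hok : c.ok = true) (hL1 : (c.n1 : ℝ) ≤ c.d * Real.log N)
    {j : ℕ} (hj : j < KU) {mlo : ℕ} (h : mLo c j = some mlo) {u : ℝ}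
    (hu : u ∈ Icc (ua j) (ua (j + 1))) :
    1 ≤ mlo ∧ mlo ≤ N / ⌈Real.exp (u * Real.log N)⌉₊ ∧ mlo ≤ N / ⌊Real.exp (u * Real.log N)⌋₊ := by
  obtain ⟨hu0, hu1⟩ := u_bounds hj hu
  obtain ⟨hC1, _, hCqt⟩ := blockIndexC_bounds hN hu0 hu1
  obtain ⟨hF1, _, hFq⟩ := blockIndexF_bounds hN hu0 hu1
  set t := Real.exp (u * Real.log N) with ht
  set q := Real.exp ((1 - u) * Real.log N) with hq
  set mC := N / ⌈t⌉₊ with hmC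
  set mF := N / ⌊t⌋₊ with hmF
  have hq0 : 0 < q := Real.exp_pos _
  have hratio := t_ratio_ge hN hu0
  rw [← ht] at hratio
  have hqlo := exp_logq_lo_le hok hL1 hj hu
  rw [← hq] at hqlo
  have hqt : q * (600 / 601) ≤ q * (t / (t + 1)) := mul_le_mul_of_nonneg_left hratio hq0.le
  have hden : 0 < 2 * KU * c.d := Nat.mul_pos (by norm_num [KU]) (d_posN hok)
  unfold mLo at h
  by_cases hbig : 14 * (2 * KU * c.d) ≤ (2 * KU - (KU + j + 1)) * c.n1
  · rw [if_pos hbig] at h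
    simp only [Option.some.injEq] at h
    subst h
    have h14 : (14 : ℝ) ≤ (((2 * KU - (KU + j + 1)) * c.n1 : ℕ) : ℝ) / ((2 * KU * c.d : ℕ) : ℝ) := by
      rw [le_div_iff₀ (by exact_mod_cast hden)]
      exact_mod_cast hbig
    have hq14 : (1202600 : ℝ) ≤ q := exp_fourteen_ge.trans ((Real.exp_le_exp.2 h14).trans hqlo)
    refine ⟨by norm_num, ?_, ?_⟩
    · have : (1000000 : ℝ) < (mC : ℝ) + 1 := by nlinarith
      have : (1000000 : ℕ) < mC + 1 := by exact_mod_cast this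
      omega
    · have : (1000000 : ℝ) < (mF : ℝ) + 1 := by nlinarith
      have : (1000000 : ℕ) < mF + 1 := by exact_mod_cast this
      omega
  · rw [if_neg hbig] at h
    split at h
    · simp at h
    rename_i Q hQ
    simp only [Option.some.injEq] at h
    subst h
    have hmem := MI.mem_exp S_pos hQ (mem_fracSpan hden hden le_rfl le_rfl)
    have hQlo : (Q.lo : ℝ) ≤ q * S := hmem.1.trans (mul_le_mul_of_nonneg_right hqlo S_posR.le)
    set Qm := max Q.lo 0 with hQm
    have hQm0 : 0 ≤ Qm := le_max_right _ _
    have hQmR : (Qm : ℝ) ≤ q * S := by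
      rw [hQm]; push_cast; exact max_le hQlo (by positivity)
    have hcast : ((Qm.toNat : ℕ) : ℝ) = (Qm : ℝ) := by
      have : ((Qm.toNat : ℕ) : ℤ) = Qm := Int.toNat_of_nonneg hQm0
      exact_mod_cast this
    set x := Qm.toNat * 600 / (601 * S) with hx
    have hxR : (x : ℝ) ≤ q * (600 / 601) := by
      have h1 : (x : ℝ) ≤ ((Qm.toNat * 600 : ℕ) : ℝ) / ((601 * S : ℕ) : ℝ) := Nat.cast_div_le
      refine h1.trans ?_
      have hpos : (0 : ℝ) < ((601 * S : ℕ) : ℝ) := by exact_mod_cast Nat.mul_pos (by norm_num) S_pos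
      rw [div_le_iff₀ hpos]
      push_cast
      rw [hcast]
      nlinarith [S_posR]
    refine ⟨le_max_left _ _, max_le hC1 ?_, max_le hF1 ?_⟩
    · have : (x : ℝ) < (mC : ℝ) + 1 := by linarith
      have : x < mC + 1 := by exact_mod_cast this
      omega
    · have : (x : ℝ) < (mF : ℝ) + 1 := by nlinarith
      have : x < mF + 1 := by exact_mod_cast this
      omega

/-- `v0 = a_j L1 ≤ u L` on the subcell. [folklore] -/
theorem v0_le (hok : c.ok = true) (hL1 : (c.n1 : ℝ) ≤ c.d * Real.log N) {j : ℕ} {u : ℝ}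
    (hu : u ∈ Icc (ua j) (ua (j + 1))) :
    (((KU + j) * c.n1 : ℕ) : ℝ) / ((2 * KU * c.d : ℕ) : ℝ) ≤ u * Real.log N := by
  have hL := L_pos hok hL1
  have hL1' := L1_le hok hL1
  have hd := d_pos hok
  have e : (((KU + j) * c.n1 : ℕ) : ℝ) / ((2 * KU * c.d : ℕ) : ℝ) = ua j * (c.n1 / c.d) := by
    unfold ua; have := KU_posR; push_cast; field_simp
  rw [e]
  calc ua j * (c.n1 / c.d) ≤ ua j * Real.log N := mul_le_mul_of_nonneg_left hL1' (ua_pos j).le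
    _ ≤ u * Real.log N := mul_le_mul_of_nonneg_right hu.1 hL.le

/-- **`tInv` bounds `1/t = N^{−u}` from above** on the subcell. [folklore] -/
theorem tInv_spec (hok : c.ok = true) (hL1 : (c.n1 : ℝ) ≤ c.d * Real.log N)
    {j : ℕ} {e0 : ℤ} (h : tInv c j = some e0) {u : ℝ} (hu : u ∈ Icc (ua j) (ua (j + 1))) :
    0 ≤ e0 ∧ e0 < S ∧ Real.exp (-(u * Real.log N)) * S ≤ e0 := by
  have hv0 := v0_le hok hL1 hu
  have hden : 0 < 2 * KU * c.d := Nat.mul_pos (by norm_num [KU]) (d_posN hok)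
  unfold tInv at h
  split at h
  · simp at h
  rename_i E hE
  by_cases hlt : max E.hi 0 < (S : ℤ)
  · rw [if_pos hlt] at h
    simp only [Option.some.injEq] at h
    subst h
    refine ⟨le_max_right _ _, hlt, le_trans ?_ (show ((E.hi : ℤ) : ℝ) ≤ ((max E.hi 0 : ℤ) : ℝ) by
      exact_mod_cast le_max_left E.hi 0)⟩
    unfold vCap at hE
    by_cases hc : (KU + j) * c.n1 ≤ 60 * (2 * KU * c.d)
    · rw [if_pos hc] at hE
      set F := fracSpan ((KU + j) * c.n1) (2 * KU * c.d) ((KU + j) * c.n1) (2 * KU * c.d) with hF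
      have hmemF : MI.mem S ((((KU + j) * c.n1 : ℕ) : ℝ) / ((2 * KU * c.d : ℕ) : ℝ)) F :=
        mem_fracSpan hden hden le_rfl le_rfl
      have hl : (F.lo : ℝ) ≤ u * Real.log N * S := hmemF.1.trans (mul_le_mul_of_nonneg_right hv0 S_posR.le)
      have h1 := MI.mem_exp S_pos hE (MI.mem_neg (MI.mem_lower S_pos F))
      refine le_trans ?_ h1.2
      refine mul_le_mul_of_nonneg_right (Real.exp_le_exp.2 ?_) S_posR.le
      rw [neg_le_neg_iff, div_le_iff₀ S_posR]; exact hl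
    · rw [if_neg hc] at hE
      have h1 := MI.mem_exp S_pos hE (MI.mem_neg (MI.mem_ofInt S 60))
      refine le_trans ?_ h1.2
      refine mul_le_mul_of_nonneg_right (Real.exp_le_exp.2 ?_) S_posR.le
      push_cast
      rw [neg_le_neg_iff]
      refine le_trans ?_ hv0
      rw [le_div_iff₀ (by exact_mod_cast hden)]
      rw [not_le] at hc
      exact_mod_cast hc.le
  · rw [if_neg hlt] at h
    simp at h

/-- **`mHi` is a valid upper index bound** for both block indices. [folklore] -/
theorem mHi_spec (hN : 360000 ≤ N) (hok : c.ok = true) (hL1 : (c.n1 : ℝ) ≤ c.d * Real.log N)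
    (hL2 : c.n2 ≠ 0 → (c.d : ℝ) * Real.log N ≤ c.n2) {j : ℕ} (hj : j < KU) {e0 : ℤ} (he00 : 0 ≤ e0)
    (he0S : e0 < S) {u : ℝ} (hu : u ∈ Icc (ua j) (ua (j + 1)))
    (he0 : Real.exp (-(u * Real.log N)) * S ≤ e0) {mhi : ℕ} (h : mHi c j e0 = some mhi) :
    N / ⌈Real.exp (u * Real.log N)⌉₊ ≤ mhi ∧ N / ⌊Real.exp (u * Real.log N)⌋₊ ≤ mhi := by
  obtain ⟨hu0, hu1⟩ := u_bounds hj hu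
  obtain ⟨_, hCq, _⟩ := blockIndexC_bounds hN hu0 hu1
  obtain ⟨_, hFqt, _⟩ := blockIndexF_bounds hN hu0 hu1
  have hL := L_pos hok hL1
  have hd := d_pos hok
  have hden : 0 < 2 * KU * c.d := Nat.mul_pos (by norm_num [KU]) (d_posN hok)
  set t := Real.exp (u * Real.log N) with ht
  set q := Real.exp ((1 - u) * Real.log N) with hq
  set mC := N / ⌈t⌉₊
  set mF := N / ⌊t⌋₊
  have ht0 : 0 < t := Real.exp_pos _
  unfold mHi at h
  by_cases hn2 : c.n2 = 0
  · simp [hn2] at h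
  rw [if_neg hn2] at h
  by_cases hcond : 10 * ((2 * KU - (KU + j)) * c.n2) ≤ 31 * (2 * KU * c.d)
  · rw [if_pos hcond] at h
    split at h
    · rename_i Q hQ
      simp only [Option.some.injEq] at h
      subst h
      have hL2' : Real.log N ≤ (c.n2 : ℝ) / c.d := L_le_L2 hok hL2 hn2
      have hqhi : q ≤ Real.exp ((((2 * KU - (KU + j)) * c.n2 : ℕ) : ℝ) / ((2 * KU * c.d : ℕ) : ℝ)) := by
        refine Real.exp_le_exp.2 ?_
        have e : (((2 * KU - (KU + j)) * c.n2 : ℕ) : ℝ) / ((2 * KU * c.d : ℕ) : ℝ) = (1 - ua j) * (c.n2 / c.d) := by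
          unfold ua
          have hsub : ((2 * KU - (KU + j) : ℕ) : ℝ) = 2 * KU - (KU + j) := by
            rw [Nat.cast_sub (by omega : KU + j ≤ 2 * KU)]; push_cast; ring
          have hK := KU_posR
          push_cast [hsub]; field_simp
        rw [e]
        have ha : ua j ≤ u := hu.1
        calc (1 - u) * Real.log N ≤ (1 - ua j) * Real.log N := mul_le_mul_of_nonneg_right (by linarith) hL.le
          _ ≤ (1 - ua j) * (c.n2 / c.d) :=
              mul_le_mul_of_nonneg_left hL2' (by linarith [ua_le_one (by omega : j ≤ KU)])
      have hmem := MI.mem_exp S_pos hQ (mem_fracSpan hden hden le_rfl le_rfl)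
      set Qm := max Q.hi 0 with hQm
      have hQm0 : 0 ≤ Qm := le_max_right _ _
      have hqS : q * S ≤ (Qm : ℝ) := by
        refine le_trans (mul_le_mul_of_nonneg_right hqhi S_posR.le) (hmem.2.trans ?_)
        exact_mod_cast le_max_left _ _
      have hcastQ : ((Qm.toNat : ℕ) : ℝ) = (Qm : ℝ) := by
        have : ((Qm.toNat : ℕ) : ℤ) = Qm := Int.toNat_of_nonneg hQm0
        exact_mod_cast this
      have hSe0 : 0 < ((S : ℤ) - e0).toNat := by omega
      have hcastS : ((((S : ℤ) - e0).toNat : ℕ) : ℝ) = (S : ℝ) - e0 := by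
        have : ((((S : ℤ) - e0).toNat : ℕ) : ℤ) = (S : ℤ) - e0 := Int.toNat_of_nonneg (by omega)
        exact_mod_cast this
      have he0R : (0 : ℝ) ≤ e0 := by exact_mod_cast he00
      constructor
      · rw [Nat.le_div_iff_mul_le hSe0]
        have : (mC : ℝ) * ((S : ℝ) - e0) ≤ Qm := by
          calc (mC : ℝ) * ((S : ℝ) - e0) ≤ (mC : ℝ) * S :=
                mul_le_mul_of_nonneg_left (by linarith) (Nat.cast_nonneg _)
            _ ≤ q * S := mul_le_mul_of_nonneg_right hCq S_posR.le
            _ ≤ Qm := hqS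
        rw [← hcastS, ← hcastQ] at this
        exact_mod_cast this
      · rw [Nat.le_div_iff_mul_le hSe0]
        have h1t : t⁻¹ * S ≤ e0 := by rw [← Real.exp_neg]; exact he0
        have hmF0 : (0 : ℝ) ≤ mF := Nat.cast_nonneg _
        have hkey : (mF : ℝ) * ((S : ℝ) - e0) ≤ q * S := by
          have h2 : (mF : ℝ) * (t - 1) ≤ q * t := hFqt
          -- multiply `S − e0 ≤ S (1 − 1/t)` i.e. `S/t ≤ e0`
          have h3 : (S : ℝ) - e0 ≤ (t - 1) * (S / t) := by
            have : t⁻¹ * S = S / t := by rw [inv_mul_eq_div]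
            rw [this] at h1t
            have e : (t - 1) * (S / t) = S - S / t := by field_simp
            rw [e]; linarith
          calc (mF : ℝ) * ((S : ℝ) - e0) ≤ (mF : ℝ) * ((t - 1) * (S / t)) := mul_le_mul_of_nonneg_left h3 hmF0
            _ = (mF : ℝ) * (t - 1) * (S / t) := by ring
            _ ≤ q * t * (S / t) := mul_le_mul_of_nonneg_right h2 (by positivity)
            _ = q * S := by field_simp
        have : (mF : ℝ) * ((S : ℝ) - e0) ≤ Qm := hkey.trans hqS
        rw [← hcastS, ← hcastQ] at this
        exact_mod_cast this
    · simp at h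
  · rw [if_neg hcond] at h
    simp at h

/-- **The exact-blocks branch is sound.** [folklore] -/
theorem smallBox_spec (hN : 360000 ≤ N) (hok : c.ok = true) (hL1 : (c.n1 : ℝ) ≤ c.d * Real.log N)
    (hL2 : c.n2 ≠ 0 → (c.d : ℝ) * Real.log N ≤ c.n2) {tS : List MC} (htSlen : tS.length = M0 + 1)
    (htS : ∀ (m : ℕ) (B : MC), tS[m]? = some B → MC.mem S ((tauN N : ℂ) * powSum (sN N) m) B)
    {j : ℕ} (hj : j < KU) {mlo : ℕ} {e0 : ℤ} (he00 : 0 ≤ e0) (he0S : e0 < S) {u : ℝ}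
    (hu : u ∈ Icc (ua j) (ua (j + 1))) (he0 : Real.exp (-(u * Real.log N)) * S ≤ e0)
    (hmloC : mlo ≤ N / ⌈Real.exp (u * Real.log N)⌉₊) (hmloF : mlo ≤ N / ⌊Real.exp (u * Real.log N)⌋₊)
    {H : MC} (h : smallBox c tS j mlo e0 = some H) :
    MC.mem S ((tauN N : ℂ) * powSum (sN N) (N / ⌈Real.exp (u * Real.log N)⌉₊)) H ∧
      MC.mem S ((tauN N : ℂ) * powSum (sN N) (N / ⌊Real.exp (u * Real.log N)⌋₊)) H := by
  unfold smallBox at h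
  split at h
  · rename_i mhi hmhi
    by_cases hcond : mhi ≤ M0 ∧ mlo ≤ mhi
    · rw [if_pos hcond] at h
      obtain ⟨hC, hF⟩ := mHi_spec hN hok hL1 hL2 hj he00 he0S hu he0 hmhi
      have hltC : N / ⌈Real.exp (u * Real.log N)⌉₊ < tS.length := by omega
      have hltF : N / ⌊Real.exp (u * Real.log N)⌋₊ < tS.length := by omega
      have hgetC := List.getElem?_eq_getElem hltC
      have hgetF := List.getElem?_eq_getElem hltF
      exact ⟨listHull_mem mhi h hmloC hC hgetC (htS _ _ hgetC), listHull_mem mhi h hmloF hF hgetF (htS _ _ hgetF)⟩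
    · rw [if_neg hcond] at h
      simp at h
  · simp at h

/-- **The widening radius dominates the enclosure error** of `norm_tau_powSum_ceil/floor_sub_le`.
[folklore] -/
theorem epsW_spec (hN : 360000 ≤ N) {T : MI} (hT : MI.mem S (tauN N) T) {mlo m : ℕ} (hmlo1 : 1 ≤ mlo)
    (hm : mlo ≤ m) {e0 : ℤ} (he0S : e0 < S) {u : ℝ} (hu0 : 1 / 2 ≤ u)
    (he0 : Real.exp (-(u * Real.log N)) * S ≤ e0) :
    tauN N * (1 / (m : ℝ) + 1 / (Real.exp (u * Real.log N) - 1) + 1 / (2 * (m : ℝ)) +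
      ‖sN N * (sN N + 1)‖ / (16 * (m : ℝ) ^ 2)) * S ≤ epsW T mlo e0 := by
  have hτ := tauN_pos hN
  have hth : tauN N * S ≤ ((max T.hi 0 : ℤ) : ℝ) := le_maxhi_of_mem hT
  set th : ℤ := max T.hi 0 with hthdef
  have hth0 : (0 : ℝ) ≤ th := le_trans (by positivity) hth
  have hm1 : (1 : ℝ) ≤ mlo := by exact_mod_cast hmlo1
  have hmm : (mlo : ℝ) ≤ m := by exact_mod_cast hm
  have hmlo0 : (0 : ℝ) < mlo := by linarith
  have hm0 : (0 : ℝ) < m := by linarith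
  have hmloZ : (0 : ℤ) < mlo := by exact_mod_cast (show 0 < mlo by omega)
  have h8 := norm_sN_mul_le hN
  set t := Real.exp (u * Real.log N) with ht
  have ht600 : (600 : ℝ) ≤ t := exp_ge hN hu0
  have ht0 : 0 < t := by linarith
  have he0S' : (e0 : ℝ) < S := by exact_mod_cast he0S
  have h1t : t⁻¹ * S ≤ e0 := by rw [← Real.exp_neg]; exact he0
  have he0pos : (0 : ℝ) < e0 := lt_of_lt_of_le (mul_pos (inv_pos.2 ht0) S_posR) h1t
  have hSe : (0 : ℝ) < (S : ℝ) - e0 := by linarith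
  have hSeZ : (0 : ℤ) < S - e0 := by omega
  have hinv : 1 / (t - 1) ≤ (e0 : ℝ) / ((S : ℝ) - e0) := by
    rw [div_le_div_iff₀ (by linarith) hSe]
    have hSt : (S : ℝ) ≤ e0 * t := by
      have := mul_le_mul_of_nonneg_left h1t ht0.le
      rw [← mul_assoc, mul_inv_cancel₀ ht0.ne', one_mul] at this
      linarith
    nlinarith
  have hτS := hth
  unfold epsW
  rw [← hthdef]
  push_cast
  have e : tauN N * (1 / (m : ℝ) + 1 / (t - 1) + 1 / (2 * (m : ℝ)) + ‖sN N * (sN N + 1)‖ / (16 * (m : ℝ) ^ 2)) * S =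
      tauN N * S * (3 / (2 * (m : ℝ))) + tauN N * S * (1 / (t - 1)) +
        tauN N * S * (‖sN N * (sN N + 1)‖ / (16 * (m : ℝ) ^ 2)) := by
    ring
  rw [e]
  refine add_le_add (add_le_add ?_ ?_) ?_
  · refine le_cdiv_of_le_div (by positivity) ?_
    push_cast
    rw [le_div_iff₀ (by positivity)]
    calc tauN N * S * (3 / (2 * (m : ℝ))) * (2 * (mlo : ℝ)) = tauN N * S * 3 * ((mlo : ℝ) / m) := by
          field_simp
      _ ≤ (th : ℝ) * 3 * 1 :=
          mul_le_mul (by nlinarith) ((div_le_one hm0).2 hmm) (by positivity) (by positivity)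
      _ = th * 3 := by ring
  · refine le_cdiv_of_le_div S_posZ ?_
    push_cast
    rw [le_div_iff₀ S_posR]
    have h2 : (e0 : ℝ) / ((S : ℝ) - e0) * S ≤ ((Numerics.cdiv (e0 * S) (S - e0) : ℤ) : ℝ) := by
      refine le_cdiv_of_mul_le hSeZ ?_
      push_cast
      rw [div_mul_eq_mul_div, div_mul_cancel₀ _ hSe.ne']
    calc tauN N * S * (1 / (t - 1)) * S ≤ (th : ℝ) * ((e0 : ℝ) / ((S : ℝ) - e0)) * S := by
          refine mul_le_mul_of_nonneg_right (mul_le_mul hth hinv (one_div_nonneg.2 (by linarith)) hth0) S_posR.le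
      _ = th * ((e0 : ℝ) / ((S : ℝ) - e0) * S) := by ring
      _ ≤ th * ((Numerics.cdiv (e0 * S) (S - e0) : ℤ) : ℝ) := mul_le_mul_of_nonneg_left h2 hth0
  · refine le_cdiv_of_le_div (by positivity) ?_
    push_cast
    rw [le_div_iff₀ (by positivity)]
    have hr : (mlo : ℝ) / m ≤ 1 := (div_le_one hm0).2 hmm
    have hr0 : 0 ≤ (mlo : ℝ) / m := by positivity
    calc tauN N * S * (‖sN N * (sN N + 1)‖ / (16 * (m : ℝ) ^ 2)) * (2 * (mlo : ℝ) ^ 2)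
        = tauN N * S * ‖sN N * (sN N + 1)‖ / 8 * ((mlo : ℝ) / m) ^ 2 := by field_simp; ring
      _ ≤ (th : ℝ) * 8 / 8 * 1 ^ 2 := by
          refine mul_le_mul ?_ (pow_le_pow_left₀ hr0 hr 2) (by positivity) (by positivity)
          refine div_le_div_of_nonneg_right ?_ (by norm_num)
          exact mul_le_mul hth h8 (norm_nonneg _) hth0
      _ = th := by ring

/-- **The block box is sound**: it contains `τ S(N/⌈N^u⌉)` and `τ S(N/⌊N^u⌋)` on the subcell.
[folklore] -/
theorem blockBox_spec (hN : 360000 ≤ N) (hok : c.ok = true) (hL1 : (c.n1 : ℝ) ≤ c.d * Real.log N)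
    (hL2 : c.n2 ≠ 0 → (c.d : ℝ) * Real.log N ≤ c.n2) {T : MI} (hT : MI.mem S (tauN N) T)
    {tS : List MC} (htSlen : tS.length = M0 + 1)
    (htS : ∀ (m : ℕ) (B : MC), tS[m]? = some B → MC.mem S ((tauN N : ℂ) * powSum (sN N) m) B)
    {d0 : MC} (hd0 : MC.mem S ((tauN N : ℂ) * emConst (sN N)) d0) {j : ℕ} (hj : j < KU)
    {u : ℝ} (hu : u ∈ Icc (ua j) (ua (j + 1))) {A0 : MC}
    (hA0 : MC.mem S ((1 - Complex.exp (-((shiftX * (1 - u) : ℝ) : ℂ) * I)) * (-I)) A0)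
    {box : MC} (h : blockBox c T tS d0 A0 j = some box) :
    MC.mem S ((tauN N : ℂ) * powSum (sN N) (N / ⌈Real.exp (u * Real.log N)⌉₊)) box ∧
      MC.mem S ((tauN N : ℂ) * powSum (sN N) (N / ⌊Real.exp (u * Real.log N)⌋₊)) box := by
  obtain ⟨hu0, hu1⟩ := u_bounds hj hu
  unfold blockBox at h
  split at h
  · rename_i mlo e0 hmlo he0
    obtain ⟨hmlo1, hmC, hmF⟩ := mLo_spec hN hok hL1 hj hmlo hu
    obtain ⟨he00, he0S, he0'⟩ := tInv_spec hok hL1 he0 hu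
    split at h
    · rename_i H hH
      simp only [Option.some.injEq] at h
      subst h
      exact smallBox_spec hN hok hL1 hL2 htSlen htS hj he00 he0S hu he0' hmC hmF hH
    · simp only [Option.some.injEq] at h
      subst h
      have hAd := MC.mem_add hA0 hd0
      constructor
      · refine MC.mem_widen hAd ?_
        refine le_trans (mul_le_mul_of_nonneg_right (norm_tau_powSum_ceil_sub_le hN hu0 hu1) S_posR.le) ?_
        exact epsW_spec hN hT hmlo1 hmC he0S hu0 he0'
      · refine MC.mem_widen hAd ?_
        refine le_trans (mul_le_mul_of_nonneg_right (norm_tau_powSum_floor_sub_le hN hu0 hu1) S_posR.le) ?_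
        exact epsW_spec hN hT hmlo1 hmF he0S hu0 he0'
  · simp at h

/-- **`eBox` encloses `e^{−iXu}/u`** on the subcell. [folklore] -/
theorem mem_eBox {piI : MI} (hpi : MI.mem S Real.pi piI) {j : ℕ} {E : MC} (h : eBox piI j = some E)
    {u : ℝ} (hu : u ∈ Icc (ua j) (ua (j + 1))) :
    MC.mem S (Complex.exp (-((shiftX * u : ℝ) : ℂ) * I) / (u : ℂ)) E := by
  obtain ⟨E', hE', rfl⟩ := Option.map_eq_some_iff.1 h
  have hK := KU_posR
  have hupos : 0 < u := lt_of_lt_of_le (ua_pos j) hu.1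
  have h8 : 0 < 8 * KU := by norm_num [KU]
  have h2 : 0 < 2 * KU := by norm_num [KU]
  have ha := hu.1
  have hb := hu.2
  unfold ua at ha hb
  rw [div_le_iff₀ twoKU_posR] at ha
  rw [le_div_iff₀ twoKU_posR] at hb
  push_cast at ha hb
  have hθ : MI.mem S (shiftX * u) (fracSpan (29 * (KU + j)) (8 * KU) (29 * (KU + j + 1)) (8 * KU)) := by
    refine mem_fracSpan h8 h8 ?_ ?_
    · unfold shiftX
      rw [div_le_iff₀ (by positivity)]
      push_cast; nlinarith
    · unfold shiftX
      rw [le_div_iff₀ (by positivity)]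
      push_cast; nlinarith
  have hinv : MI.mem S u⁻¹ (fracSpan (2 * KU) (KU + j + 1) (2 * KU) (KU + j)) := by
    refine mem_fracSpan (by positivity) (by omega) ?_ ?_
    · rw [div_le_iff₀ (by positivity), ← div_eq_inv_mul, le_div_iff₀ hupos]
      push_cast; nlinarith
    · rw [le_div_iff₀ (Nat.cast_pos.2 (Nat.add_pos_left KU_pos j)), ← div_eq_inv_mul, div_le_iff₀ hupos]
      push_cast; nlinarith
  have h1 := MC.mem_mulMI S_pos (mem_expNegIC hpi hE' hθ) hinv
  convert h1 using 2
  rw [div_eq_mul_inv]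
  push_cast
  rfl

/-- **`a0Box` encloses `(1 − e^{−iX(1−u)})(−i)`** on the subcell. [folklore] -/
theorem mem_a0Box {piI : MI} (hpi : MI.mem S Real.pi piI) {j : ℕ} (hj : j < KU) {A : MC}
    (h : a0Box piI j = some A) {u : ℝ} (hu : u ∈ Icc (ua j) (ua (j + 1))) :
    MC.mem S ((1 - Complex.exp (-((shiftX * (1 - u) : ℝ) : ℂ) * I)) * (-I)) A := by
  obtain ⟨F, hF, rfl⟩ := Option.map_eq_some_iff.1 h
  have hK := KU_posR
  have h8 : 0 < 8 * KU := by norm_num [KU]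
  have ha := hu.1
  have hb := hu.2
  unfold ua at ha hb
  rw [div_le_iff₀ twoKU_posR] at ha
  rw [le_div_iff₀ twoKU_posR] at hb
  push_cast at ha hb
  have hs1 : ((KU - j - 1 : ℕ) : ℝ) = (KU : ℝ) - j - 1 := by
    rw [Nat.sub_sub, Nat.cast_sub (by omega : j + 1 ≤ KU)]; push_cast; ring
  have hs2 : ((KU - j : ℕ) : ℝ) = (KU : ℝ) - j := by
    rw [Nat.cast_sub (by omega : j ≤ KU)]
  have hθ : MI.mem S (shiftX * (1 - u)) (fracSpan (29 * (KU - j - 1)) (8 * KU) (29 * (KU - j)) (8 * KU)) := by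
    refine mem_fracSpan h8 h8 ?_ ?_
    · unfold shiftX
      rw [div_le_iff₀ (by positivity)]
      push_cast [hs1]; nlinarith
    · unfold shiftX
      rw [le_div_iff₀ (by positivity)]
      push_cast [hs2]; nlinarith
  have h1 := MC.mem_mulNegI (MC.mem_sub (MC.mem_ofInt S 1) (mem_expNegIC hpi hF hθ))
  simpa using h1

/-- **The envelope bound on the subcell.** [folklore] -/
theorem etaU_spec (hok : c.ok = true) (hL1 : (c.n1 : ℝ) ≤ c.d * Real.log N)
    (hL2 : c.n2 ≠ 0 → (c.d : ℝ) * Real.log N ≤ c.n2) {piI : MI} (hpi : MI.mem S Real.pi piI)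
    {j : ℕ} {η : ℤ} (h : etaU piI c j = some η) {u : ℝ} (hu : u ∈ Icc (ua j) (ua (j + 1))) :
    thetaEnv (Real.exp (u * Real.log N)) / Real.exp (u * Real.log N) * S ≤ η := by
  have hL := L_pos hok hL1
  have hd := d_pos hok
  have hden : 0 < 2 * KU * c.d := Nat.mul_pos (by norm_num [KU]) (d_posN hok)
  set v : ℝ := (((KU + j) * c.n1 : ℕ) : ℝ) / ((2 * KU * c.d : ℕ) : ℝ) with hv
  have hev : v = ua j * (c.n1 / c.d) := by rw [hv]; unfold ua; have := KU_posR; push_cast; field_simp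
  have hmem : MI.mem S v (fracSpan ((KU + j) * c.n1) (2 * KU * c.d) ((KU + j) * c.n1) (2 * KU * c.d)) :=
    mem_fracSpan hden hden le_rfl le_rfl
  have hL125 := L1_ge hok
  have hv4 : 4 ≤ v := by
    rw [hev]; have := half_le_ua j; nlinarith
  have hvu : v ≤ u * Real.log N := v0_le hok hL1 hu
  refine etaHat_spec hpi h hmem hv4 (Real.exp_le_exp.2 hvu) ?_
  intro hbz
  obtain ⟨hn2, hle⟩ := of_decide_eq_true hbz
  have hn2' : c.n2 ≠ 0 := by omega
  have hL2' : Real.log N ≤ (c.n2 : ℝ) / c.d := L_le_L2 hok hL2 hn2'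
  refine le_trans (Real.exp_le_exp.2 ?_) exp_sixteen_le_thetaZ
  have hb : u ≤ ua (j + 1) := hu.2
  have hle' : (((KU + j + 1) * c.n2 : ℕ) : ℝ) ≤ ((16 * (2 * KU) * c.d : ℕ) : ℝ) := by exact_mod_cast hle
  push_cast at hle'
  calc u * Real.log N ≤ ua (j + 1) * ((c.n2 : ℝ) / c.d) := mul_le_mul hb hL2' hL.le (ua_pos _).le
    _ ≤ 16 := by
        unfold ua
        rw [div_mul_div_comm, div_le_iff₀ (mul_pos twoKU_posR hd)]
        push_cast
        nlinarith

/-- `‖1 + iτ‖ S ≤ cHiS`. [folklore] -/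
theorem cHiS_spec (hN : 360000 ≤ N) {T : MI} (hT : MI.mem S (tauN N) T) :
    ‖(1 : ℂ) + tauN N * I‖ * S ≤ cHiS T := by
  have hτ := tauN_pos hN
  have hth : tauN N * S ≤ ((max T.hi 0 : ℤ) : ℝ) := le_maxhi_of_mem hT
  set th : ℤ := max T.hi 0 with hthdef
  have hth0 : (0 : ℝ) ≤ th := le_trans (by positivity) hth
  have hn : ‖(1 : ℂ) + tauN N * I‖ ≤ 1 + tauN N ^ 2 / 2 := by
    have h1 : ‖(1 : ℂ) + tauN N * I‖ ^ 2 = 1 + tauN N ^ 2 := by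
      rw [Complex.sq_norm, Complex.normSq_apply]; simp; ring
    nlinarith [norm_nonneg ((1 : ℂ) + tauN N * I), sq_nonneg (tauN N), sq_nonneg (tauN N ^ 2)]
  have hsq : (tauN N * S) * (tauN N * S) ≤ (th : ℝ) * th := mul_le_mul hth hth (by positivity) hth0
  unfold cHiS
  rw [← hthdef]
  have hc : (th : ℝ) * th / (2 * S) ≤ ((Numerics.cdiv (th * th) (2 * S) : ℤ) : ℝ) := by
    refine le_cdiv_of_le_div (mul_pos (by norm_num) S_posZ) ?_
    push_cast; exact le_rfl
  push_cast
  calc ‖(1 : ℂ) + tauN N * I‖ * S ≤ (1 + tauN N ^ 2 / 2) * S := mul_le_mul_of_nonneg_right hn S_posR.le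
    _ = S + (tauN N * S) * (tauN N * S) / (2 * S) := by field_simp
    _ ≤ S + (th : ℝ) * th / (2 * S) := by
        refine add_le_add le_rfl (div_le_div_of_nonneg_right hsq (by positivity))
    _ ≤ S + ((Numerics.cdiv (th * th) (2 * S) : ℤ) : ℝ) := add_le_add le_rfl hc

end USub

/-! ## The four `u`-integrands and the subcell contributions -/

/-- The `B` main integrand `e^{−iXu}/u · S(N/⌈N^u⌉)`. [folklore] -/
def fB (N : ℕ) (u : ℝ) : ℂ :=
  Complex.exp (-((shiftX * u : ℝ) : ℂ) * I) / (u : ℂ) * stepC (powSum (sN N)) N (Real.exp (u * Real.log N))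

/-- The `R` main integrand `‖S(N/⌈N^u⌉)‖/u`. [folklore] -/
def fR (N : ℕ) (u : ℝ) : ℝ := ‖stepC (powSum (sN N)) N (Real.exp (u * Real.log N))‖ / u

/-- The `B` variation integrand. [folklore] -/
def gB (N : ℕ) (u : ℝ) : ℝ :=
  thetaEnv (Real.exp (u * Real.log N)) * Real.exp (-(u * Real.log N)) *
    ((‖(1 : ℂ) + tauN N * I‖ * (u * Real.log N) + 1) / (u ^ 2 * Real.log N)) *
      ‖stepF (powSum (sN N)) N (Real.exp (u * Real.log N))‖

/-- The `R` variation integrand. [folklore] -/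
def gR (N : ℕ) (u : ℝ) : ℝ :=
  thetaEnv (Real.exp (u * Real.log N)) * Real.exp (-(u * Real.log N)) *
    ((u * Real.log N + 1) / (u ^ 2 * Real.log N)) *
      ‖stepF (powSum (sN N)) N (Real.exp (u * Real.log N))‖

/-- [folklore] -/
theorem mainB_eq (N : ℕ) : mainB N = (1 - Complex.exp (-((shiftX : ℝ) : ℂ) * I)) / ((tauN N : ℂ) * I) +
    emConst (sN N) - ∫ u in (uM N)..1, fB N u := rfl

/-- [folklore] -/
theorem mainR_eq (N : ℕ) : mainR N = ∫ u in (uM N)..1, fR N u := rfl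

/-- [folklore] -/
theorem errIntB_eq (N : ℕ) : errIntB N = ∫ u in (uM1 N)..1, gB N u := rfl

/-- [folklore] -/
theorem errIntR_eq (N : ℕ) : errIntR N = ∫ u in (uM1 N)..1, gR N u := rfl

/-- [folklore] -/
theorem ii_fB (N : ℕ) {a b : ℝ} (ha : 0 < a) (hab : a ≤ b) : IntervalIntegrable (fB N) volume a b :=
  intervalIntegrable_mainB_integrand ha hab

/-- [folklore] -/
theorem ii_fR (N : ℕ) {a b : ℝ} (ha : 0 < a) (hab : a ≤ b) : IntervalIntegrable (fR N) volume a b :=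
  intervalIntegrable_mainR_integrand ha hab

/-- [folklore] -/
theorem ii_gB {N : ℕ} (hN : 360000 ≤ N) {a b : ℝ} (ha : 0 < a) (hab : a ≤ b) :
    IntervalIntegrable (gB N) volume a b :=
  intervalIntegrable_errB_integrand hN ha hab

/-- [folklore] -/
theorem ii_gR {N : ℕ} (hN : 360000 ≤ N) {a b : ℝ} (ha : 0 < a) (hab : a ≤ b) :
    IntervalIntegrable (gR N) volume a b :=
  intervalIntegrable_errR_integrand hN ha hab

/-- `fR ≥ 0` for `u > 0`. [folklore] -/
theorem fR_nonneg (N : ℕ) {u : ℝ} (hu : 0 < u) : 0 ≤ fR N u := by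
  unfold fR; positivity

/-- `gB, gR ≥ 0` for `u > 0`. [folklore] -/
theorem gB_nonneg {N : ℕ} (hN : 360000 ≤ N) {u : ℝ} (hu : 0 < u) : 0 ≤ gB N u ∧ 0 ≤ gR N u := by
  have hL := log_pos hN
  have h1 : 1 ≤ Real.exp (u * Real.log N) := Real.one_le_exp (by positivity)
  have hθ := thetaEnv_nonneg h1
  unfold gB gR
  exact ⟨by positivity, by positivity⟩

/-- **Averaging a box-valued bound**: if `g(u) ∈ P` on `[a, b]` then `(b − a)⁻¹ ∫_a^b g ∈ P`.
[folklore] -/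
theorem mem_avg_integral {g : ℝ → ℂ} {a b : ℝ} (hab : a < b) (hg : IntervalIntegrable g volume a b)
    {P : MC} (h : ∀ u ∈ Icc a b, MC.mem S (g u) P) :
    MC.mem S ((((b - a)⁻¹ : ℝ) : ℂ) * ∫ u in a..b, g u) P := by
  have hba : 0 < b - a := by linarith
  have hre := re_integral_bounds hab.le hg (lo := (P.re.lo : ℝ) / S) (hi := (P.re.hi : ℝ) / S)
    (fun u hu ↦ ⟨by rw [div_le_iff₀ S_posR]; exact (h u hu).1.1, by rw [le_div_iff₀ S_posR]; exact (h u hu).1.2⟩)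
  have him := im_integral_bounds hab.le hg (lo := (P.im.lo : ℝ) / S) (hi := (P.im.hi : ℝ) / S)
    (fun u hu ↦ ⟨by rw [div_le_iff₀ S_posR]; exact (h u hu).2.1, by rw [le_div_iff₀ S_posR]; exact (h u hu).2.2⟩)
  have e : ∀ x : ℝ, (b - a)⁻¹ * x * S = x * S / (b - a) := by
    intro x; rw [inv_mul_eq_div, div_mul_eq_mul_div]
  constructor
  · constructor
    · rw [Complex.re_ofReal_mul, e, le_div_iff₀ hba]
      have := hre.1
      rw [mul_div_assoc', div_le_iff₀ S_posR] at this
      linarith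
    · rw [Complex.re_ofReal_mul, e, div_le_iff₀ hba]
      have := hre.2
      rw [mul_div_assoc', le_div_iff₀ S_posR] at this
      linarith
  · constructor
    · rw [Complex.im_ofReal_mul, e, le_div_iff₀ hba]
      have := him.1
      rw [mul_div_assoc', div_le_iff₀ S_posR] at this
      linarith
    · rw [Complex.im_ofReal_mul, e, div_le_iff₀ hba]
      have := him.2
      rw [mul_div_assoc', le_div_iff₀ S_posR] at this
      linarith

/-- One-sided quadrature bounds. [folklore] -/
theorem lo_le_integral {g : ℝ → ℝ} {a b lo : ℝ} (hab : a ≤ b) (hg : IntervalIntegrable g volume a b)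
    (h : ∀ u ∈ Icc a b, lo ≤ g u) : (b - a) * lo ≤ ∫ u in a..b, g u := by
  have := intervalIntegral.integral_mono_on hab intervalIntegrable_const hg fun u hu ↦ h u hu
  rwa [intervalIntegral.integral_const, smul_eq_mul] at this

/-- [folklore] -/
theorem integral_le_hi {g : ℝ → ℝ} {a b hi : ℝ} (hab : a ≤ b) (hg : IntervalIntegrable g volume a b)
    (h : ∀ u ∈ Icc a b, g u ≤ hi) : ∫ u in a..b, g u ≤ (b - a) * hi := by
  have := intervalIntegral.integral_mono_on hab hg intervalIntegrable_const fun u hu ↦ h u hu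
  rwa [intervalIntegral.integral_const, smul_eq_mul] at this

section Step

variable {c : Cell} {N : ℕ}

/-- The variation coefficient bound: `(c uL + 1)/(u² L) ≤ c'/a + w2/a²` for `c ≤ c'`, `a ≤ u`,
`1/L ≤ w2`. [folklore] -/
theorem coef_le {cv cv' u a L w2 : ℝ} (hc : cv ≤ cv') (hc0 : 0 ≤ cv) (ha : 0 < a) (hau : a ≤ u)
    (hL : 0 < L) (hw : 1 / L ≤ w2) :
    (cv * (u * L) + 1) / (u ^ 2 * L) ≤ cv' / a + w2 / a ^ 2 := by
  have hu : 0 < u := lt_of_lt_of_le ha hau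
  have e : (cv * (u * L) + 1) / (u ^ 2 * L) = cv / u + (1 / L) / u ^ 2 := by
    field_simp
  rw [e]
  refine add_le_add ?_ ?_
  · exact div_le_div₀ (hc0.trans hc) hc ha hau
  · exact div_le_div₀ (le_trans (by positivity) hw) hw (by positivity) (pow_le_pow_left₀ ha.le hau 2)

/-- **The subcell computation is sound**: on `[a_j, b_j]`, `τ f_B ∈ P_j`,
`ir_j ≤ τ f_R · S/(2KU)`, and `τ g_{B,R} · S/(2KU) ≤ ieb_j, ier_j`. [folklore] -/
theorem uStep_spec (hN : 360000 ≤ N) (hok : c.ok = true) (hL1 : (c.n1 : ℝ) ≤ c.d * Real.log N)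
    (hL2 : c.n2 ≠ 0 → (c.d : ℝ) * Real.log N ≤ c.n2) {piI : MI} (hpi : MI.mem S Real.pi piI)
    {T : MI} (hT : MI.mem S (tauN N) T) {tS : List MC} (htSlen : tS.length = M0 + 1)
    (htS : ∀ (m : ℕ) (B : MC), tS[m]? = some B → MC.mem S ((tauN N : ℂ) * powSum (sN N) m) B)
    {d0 : MC} (hd0 : MC.mem S ((tauN N : ℂ) * emConst (sN N)) d0) {j : ℕ} (hj : j < KU)
    {o : UOut} (h : uStep piI c T tS d0 j = some o) {u : ℝ} (hu : u ∈ Icc (ua j) (ua (j + 1))) :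
    MC.mem S ((tauN N : ℂ) * fB N u) o.P ∧
      (o.ir : ℝ) ≤ tauN N * fR N u * (S / ((2 * KU : ℕ) : ℝ)) ∧
      tauN N * gB N u * (S / ((2 * KU : ℕ) : ℝ)) ≤ o.ieb ∧
      tauN N * gR N u * (S / ((2 * KU : ℕ) : ℝ)) ≤ o.ier := by
  have hτ := tauN_pos hN
  have hL := log_pos hN
  obtain ⟨hu0, hu1⟩ := u_bounds hj hu
  have hupos : 0 < u := by linarith
  have ha := hu.1
  have hb := hu.2
  have hapos := ua_pos j
  unfold uStep at h
  split at h
  · rename_i A0 E eta hA0 hE heta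
    split at h
    · simp at h
    rename_i box hbox
    simp only [Option.some.injEq] at h
    subst h
    simp only []
    obtain ⟨hbC, hbF⟩ := blockBox_spec hN hok hL1 hL2 hT htSlen htS hd0 hj hu (mem_a0Box hpi hj hA0 hu) hbox
    have hEm := mem_eBox hpi hE hu
    have hetaR := etaU_spec hok hL1 hL2 hpi heta hu
    set t := Real.exp (u * Real.log N) with ht
    set mC := N / ⌈t⌉₊ with hmC
    set mF := N / ⌊t⌋₊ with hmF
    have ht0 : 0 < t := Real.exp_pos _
    have ht1 : 1 ≤ t := Real.one_le_exp (by positivity)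
    -- norms
    have hnC : ‖(tauN N : ℂ) * powSum (sN N) mC‖ = tauN N * ‖powSum (sN N) mC‖ := by
      rw [norm_mul, Complex.norm_real, Real.norm_eq_abs, abs_of_pos hτ]
    have hnF : ‖(tauN N : ℂ) * powSum (sN N) mF‖ = tauN N * ‖powSum (sN N) mF‖ := by
      rw [norm_mul, Complex.norm_real, Real.norm_eq_abs, abs_of_pos hτ]
    have hlo := normLo_le_norm hbC
    have hhi := norm_le_normHi hbF
    rw [hnC] at hlo
    rw [hnF] at hhi
    set nlo := normLo box with hnlo
    set nhi := normHi box with hnhi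
    -- geometry of the subcell
    have hK2 := twoKU_posR
    have hbval : ua (j + 1) * ((2 * KU : ℕ) : ℝ) = ((KU + j + 1 : ℕ) : ℝ) := by
      unfold ua; rw [div_mul_cancel₀ _ hK2.ne']; push_cast; ring
    have haval : ua j * ((2 * KU : ℕ) : ℝ) = ((KU + j : ℕ) : ℝ) := by
      unfold ua; rw [div_mul_cancel₀ _ hK2.ne']
    have hKj : (0 : ℝ) < ((KU + j : ℕ) : ℝ) := by rw [← haval]; positivity
    have hKj1 : (0 : ℝ) < ((KU + j + 1 : ℕ) : ℝ) := by positivity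
    refine ⟨?_, ?_, ?_, ?_⟩
    · -- (1) the `IB` integrand
      have e : (tauN N : ℂ) * fB N u = Complex.exp (-((shiftX * u : ℝ) : ℂ) * I) / (u : ℂ) *
          ((tauN N : ℂ) * powSum (sN N) mC) := by
        unfold fB stepC; rw [← hmC]; ring
      rw [e]
      exact MC.mem_mul S_pos hEm hbC
    · -- (2) the `IR` lower bound
      have h1 : (((nlo : ℤ) / (KU + j + 1 : ℕ) : ℤ) : ℝ) ≤ (nlo : ℝ) / ((KU + j + 1 : ℕ) : ℝ) := by
        have := Numerics.fdiv_le_div (a := (nlo : ℤ)) (b := (KU + j + 1 : ℕ)) (by positivity)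
        push_cast at this ⊢
        exact this
      refine h1.trans ?_
      have hS0 : 0 ≤ tauN N * ‖powSum (sN N) mC‖ * S := by positivity
      calc (nlo : ℝ) / ((KU + j + 1 : ℕ) : ℝ) ≤ tauN N * ‖powSum (sN N) mC‖ * S / ((KU + j + 1 : ℕ) : ℝ) :=
            div_le_div_of_nonneg_right hlo hKj1.le
        _ ≤ tauN N * ‖powSum (sN N) mC‖ * S / (u * ((2 * KU : ℕ) : ℝ)) := by
            refine div_le_div_of_nonneg_left hS0 (by positivity) ?_
            rw [← hbval]; exact mul_le_mul_of_nonneg_right hb hK2.le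
        _ = tauN N * fR N u * (S / ((2 * KU : ℕ) : ℝ)) := by
            unfold fR stepC; rw [← hmC]; have hS := S_neR; field_simp
    · -- (3) the `IEB` upper bound
      have hθ0 : 0 ≤ thetaEnv t / t := div_nonneg (thetaEnv_nonneg ht1) ht0.le
      set eta' : ℤ := max eta 0 with heta'
      have hθ : thetaEnv t / t ≤ (eta' : ℝ) / S := by
        rw [le_div_iff₀ S_posR]; exact hetaR.trans (by rw [heta']; exact_mod_cast le_max_left _ _)
      have heta'0 : (0 : ℝ) ≤ eta' := by rw [heta']; exact_mod_cast le_max_right _ _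
      have hcv := cHiS_spec hN hT
      set cr : ℝ := (cHiS T : ℝ) / S with hcr
      have hccr : ‖(1 : ℂ) + tauN N * I‖ ≤ cr := by rw [hcr, le_div_iff₀ S_posR]; exact hcv
      have hcoef := coef_le hccr (norm_nonneg _) hapos ha hL (w_le hok hL1)
      have hcoef0 : 0 ≤ (‖(1 : ℂ) + tauN N * I‖ * (u * Real.log N) + 1) / (u ^ 2 * Real.log N) := by positivity
      have hSF : tauN N * ‖powSum (sN N) mF‖ ≤ (nhi : ℝ) / S := by rw [le_div_iff₀ S_posR]; exact hhi
      have hSF0 : 0 ≤ tauN N * ‖powSum (sN N) mF‖ := by positivity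
      -- `τ gB = (θ/t) · coef · (τ ‖S(mF)‖)`
      have e : tauN N * gB N u = thetaEnv t / t *
          ((‖(1 : ℂ) + tauN N * I‖ * (u * Real.log N) + 1) / (u ^ 2 * Real.log N)) *
            (tauN N * ‖powSum (sN N) mF‖) := by
        unfold gB stepF; rw [Real.exp_neg, ← ht, ← hmF]; field_simp
      have hcr0 : 0 ≤ cr := le_trans (norm_nonneg _) hccr
      have hprod : tauN N * gB N u ≤ (eta' : ℝ) / S * (cr / ua j + (c.d : ℝ) / c.n1 / ua j ^ 2) * ((nhi : ℝ) / S) := by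
        rw [e]
        exact mul_le_mul (mul_le_mul hθ hcoef hcoef0 (by positivity)) hSF hSF0 (by positivity)
      set G : ℝ := (eta' : ℝ) * nhi / S with hG
      set g : ℤ := Numerics.cdiv (eta' * nhi) S with hg
      have hGg : G ≤ g := by rw [hG, hg]; refine le_cdiv_of_le_div S_posZ ?_; push_cast; exact le_rfl
      have hG0 : 0 ≤ G := by rw [hG]; positivity
      have hg0 : (0 : ℝ) ≤ g := hG0.trans hGg
      -- rewrite the bound in terms of `G`
      have e2 : (eta' : ℝ) / S * (cr / ua j + (c.d : ℝ) / c.n1 / ua j ^ 2) * ((nhi : ℝ) / S) * (S / ((2 * KU : ℕ) : ℝ)) =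
          G * (cHiS T : ℝ) / (S * ((KU + j : ℕ) : ℝ)) + G * c.d * ((2 * KU : ℕ) : ℝ) / (c.n1 * ((KU + j : ℕ) : ℝ) ^ 2) := by
        rw [hG, hcr, ← haval]
        have hn1 := n1_pos hok
        have hS := S_neR
        field_simp
      calc tauN N * gB N u * (S / ((2 * KU : ℕ) : ℝ))
          ≤ (eta' : ℝ) / S * (cr / ua j + (c.d : ℝ) / c.n1 / ua j ^ 2) * ((nhi : ℝ) / S) * (S / ((2 * KU : ℕ) : ℝ)) :=
            mul_le_mul_of_nonneg_right hprod (by positivity)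
        _ = G * (cHiS T : ℝ) / (S * ((KU + j : ℕ) : ℝ)) + G * c.d * ((2 * KU : ℕ) : ℝ) / (c.n1 * ((KU + j : ℕ) : ℝ) ^ 2) := e2
        _ ≤ (g : ℝ) * (cHiS T : ℝ) / (S * ((KU + j : ℕ) : ℝ)) + (g : ℝ) * c.d * ((2 * KU : ℕ) : ℝ) / (c.n1 * ((KU + j : ℕ) : ℝ) ^ 2) := by
            have hc0 : (0 : ℝ) ≤ cHiS T := le_trans (by positivity) hcv
            have hn1 := n1_pos hok
            exact add_le_add (div_le_div_of_nonneg_right (mul_le_mul_of_nonneg_right hGg hc0) (by positivity))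
              (div_le_div_of_nonneg_right (mul_le_mul_of_nonneg_right
                (mul_le_mul_of_nonneg_right hGg (Nat.cast_nonneg _)) hK2.le) (by positivity))
        _ ≤ (iebOf c T j g : ℝ) := by
            unfold iebOf
            push_cast
            refine add_le_add ?_ ?_
            · exact le_cdiv_of_le_div (by exact_mod_cast mul_pos S_pos (Nat.add_pos_left KU_pos j))
                (le_of_eq (by push_cast; ring))
            · exact le_cdiv_of_le_div (by exact_mod_cast mul_pos (n1_posN hok) (pow_pos (Nat.add_pos_left KU_pos j) 2))
                (le_of_eq (by push_cast; ring))
    · -- (4) the `IER` upper bound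
      have hθ0 : 0 ≤ thetaEnv t / t := div_nonneg (thetaEnv_nonneg ht1) ht0.le
      set eta' : ℤ := max eta 0 with heta'
      have hθ : thetaEnv t / t ≤ (eta' : ℝ) / S := by
        rw [le_div_iff₀ S_posR]; exact hetaR.trans (by rw [heta']; exact_mod_cast le_max_left _ _)
      have heta'0 : (0 : ℝ) ≤ eta' := by rw [heta']; exact_mod_cast le_max_right _ _
      have hcoef := coef_le (le_refl (1 : ℝ)) zero_le_one hapos ha hL (w_le hok hL1)
      rw [one_mul] at hcoef
      have hcoef0 : 0 ≤ (u * Real.log N + 1) / (u ^ 2 * Real.log N) := by positivity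
      have hSF : tauN N * ‖powSum (sN N) mF‖ ≤ (nhi : ℝ) / S := by rw [le_div_iff₀ S_posR]; exact hhi
      have hSF0 : 0 ≤ tauN N * ‖powSum (sN N) mF‖ := by positivity
      have e : tauN N * gR N u = thetaEnv t / t * ((u * Real.log N + 1) / (u ^ 2 * Real.log N)) *
            (tauN N * ‖powSum (sN N) mF‖) := by
        unfold gR stepF; rw [Real.exp_neg, ← ht, ← hmF]; field_simp
      have hprod : tauN N * gR N u ≤ (eta' : ℝ) / S * (1 / ua j + (c.d : ℝ) / c.n1 / ua j ^ 2) * ((nhi : ℝ) / S) := by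
        rw [e]
        exact mul_le_mul (mul_le_mul hθ hcoef hcoef0 (by positivity)) hSF hSF0 (by positivity)
      set G : ℝ := (eta' : ℝ) * nhi / S with hG
      set g : ℤ := Numerics.cdiv (eta' * nhi) S with hg
      have hGg : G ≤ g := by rw [hG, hg]; refine le_cdiv_of_le_div S_posZ ?_; push_cast; exact le_rfl
      have hG0 : 0 ≤ G := by rw [hG]; positivity
      have hg0 : (0 : ℝ) ≤ g := hG0.trans hGg
      have e2 : (eta' : ℝ) / S * (1 / ua j + (c.d : ℝ) / c.n1 / ua j ^ 2) * ((nhi : ℝ) / S) * (S / ((2 * KU : ℕ) : ℝ)) =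
          G / ((KU + j : ℕ) : ℝ) + G * c.d * ((2 * KU : ℕ) : ℝ) / (c.n1 * ((KU + j : ℕ) : ℝ) ^ 2) := by
        rw [hG, ← haval]
        have hn1 := n1_pos hok
        have hS := S_neR
        field_simp
      calc tauN N * gR N u * (S / ((2 * KU : ℕ) : ℝ))
          ≤ (eta' : ℝ) / S * (1 / ua j + (c.d : ℝ) / c.n1 / ua j ^ 2) * ((nhi : ℝ) / S) * (S / ((2 * KU : ℕ) : ℝ)) :=
            mul_le_mul_of_nonneg_right hprod (by positivity)
        _ = G / ((KU + j : ℕ) : ℝ) + G * c.d * ((2 * KU : ℕ) : ℝ) / (c.n1 * ((KU + j : ℕ) : ℝ) ^ 2) := e2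
        _ ≤ (g : ℝ) / ((KU + j : ℕ) : ℝ) + (g : ℝ) * c.d * ((2 * KU : ℕ) : ℝ) / (c.n1 * ((KU + j : ℕ) : ℝ) ^ 2) := by
            have hn1 := n1_pos hok
            exact add_le_add (div_le_div_of_nonneg_right hGg (by positivity))
              (div_le_div_of_nonneg_right (mul_le_mul_of_nonneg_right
                (mul_le_mul_of_nonneg_right hGg (Nat.cast_nonneg _)) hK2.le) (by positivity))
        _ ≤ (ierOf c j g : ℝ) := by
            unfold ierOf
            push_cast
            refine add_le_add ?_ ?_
            · exact le_cdiv_of_le_div (by exact_mod_cast (Nat.add_pos_left KU_pos j))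
                (le_of_eq (by push_cast; ring))
            · exact le_cdiv_of_le_div (by exact_mod_cast mul_pos (n1_posN hok) (pow_pos (Nat.add_pos_left KU_pos j) 2))
                (le_of_eq (by push_cast; ring))
  · simp at h

/-- **The running sums are sound**: after `n ≤ KU` subcells, `IB ∋ 2KU · τ ∫_{½}^{a_n} f_B`,
`IR ≤ S τ ∫_{½}^{a_n} f_R`, and `IEB, IER ≥ S τ ∫_{½}^{a_n} g_{B,R}`. [folklore] -/
theorem uSums_spec (hN : 360000 ≤ N) (hok : c.ok = true) (hL1 : (c.n1 : ℝ) ≤ c.d * Real.log N)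
    (hL2 : c.n2 ≠ 0 → (c.d : ℝ) * Real.log N ≤ c.n2) {piI : MI} (hpi : MI.mem S Real.pi piI)
    {T : MI} (hT : MI.mem S (tauN N) T) {tS : List MC} (htSlen : tS.length = M0 + 1)
    (htS : ∀ (m : ℕ) (B : MC), tS[m]? = some B → MC.mem S ((tauN N : ℂ) * powSum (sN N) m) B)
    {d0 : MC} (hd0 : MC.mem S ((tauN N : ℂ) * emConst (sN N)) d0) :
    ∀ (n : ℕ) {us : USum}, uSums piI c T tS d0 n = some us → n ≤ KU →
      MC.mem S ((((2 * KU : ℕ) : ℝ) : ℂ) * ((tauN N : ℂ) * ∫ u in (1 / 2 : ℝ)..ua n, fB N u)) us.IB ∧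
      (us.IR : ℝ) ≤ S * (tauN N * ∫ u in (1 / 2 : ℝ)..ua n, fR N u) ∧
      S * (tauN N * ∫ u in (1 / 2 : ℝ)..ua n, gB N u) ≤ us.IEB ∧
      S * (tauN N * ∫ u in (1 / 2 : ℝ)..ua n, gR N u) ≤ us.IER := by
  have hτ := tauN_pos hN
  intro n
  induction n with
  | zero =>
    intro us h _
    simp only [uSums, Option.some.injEq] at h
    subst h
    simp only [ua_zero, intervalIntegral.integral_same, mul_zero]
    refine ⟨?_, by push_cast; exact le_rfl, by push_cast; exact le_rfl, by push_cast; exact le_rfl⟩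
    have := MC.mem_ofInt S 0
    simpa using this
  | succ n ih =>
    intro us h hn
    simp only [uSums] at h
    split at h
    · rename_i s o hs ho
      simp only [Option.some.injEq] at h
      subst h
      simp only []
      obtain ⟨i1, i2, i3, i4⟩ := ih hs (by omega)
      have hj : n < KU := by omega
      have hstep := fun u hu ↦ uStep_spec hN hok hL1 hL2 hpi hT htSlen htS hd0 hj ho (u := u) hu
      set a := ua n with hadef
      set b := ua (n + 1) with hbdef
      have hab : a < b := ua_lt_succ n
      have ha : 0 < a := ua_pos n
      have hha : 1 / 2 ≤ a := half_le_ua n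
      have hba : b - a = 1 / ((2 * KU : ℕ) : ℝ) := ua_succ_sub n
      have hK2 := twoKU_posR
      -- splitting the integrals at `a`
      have sB : ∫ u in (1 / 2 : ℝ)..b, fB N u = (∫ u in (1 / 2 : ℝ)..a, fB N u) + ∫ u in a..b, fB N u :=
        (intervalIntegral.integral_add_adjacent_intervals (ii_fB N (by norm_num) hha) (ii_fB N ha hab.le)).symm
      have sR : ∫ u in (1 / 2 : ℝ)..b, fR N u = (∫ u in (1 / 2 : ℝ)..a, fR N u) + ∫ u in a..b, fR N u :=
        (intervalIntegral.integral_add_adjacent_intervals (ii_fR N (by norm_num) hha) (ii_fR N ha hab.le)).symm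
      have sGB : ∫ u in (1 / 2 : ℝ)..b, gB N u = (∫ u in (1 / 2 : ℝ)..a, gB N u) + ∫ u in a..b, gB N u :=
        (intervalIntegral.integral_add_adjacent_intervals (ii_gB hN (by norm_num) hha) (ii_gB hN ha hab.le)).symm
      have sGR : ∫ u in (1 / 2 : ℝ)..b, gR N u = (∫ u in (1 / 2 : ℝ)..a, gR N u) + ∫ u in a..b, gR N u :=
        (intervalIntegral.integral_add_adjacent_intervals (ii_gR hN (by norm_num) hha) (ii_gR hN ha hab.le)).symm
      refine ⟨?_, ?_, ?_, ?_⟩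
      · rw [sB, mul_add, mul_add]
        refine MC.mem_add i1 ?_
        have hint : IntervalIntegrable (fun u ↦ (tauN N : ℂ) * fB N u) volume a b := (ii_fB N ha hab.le).const_mul _
        have hm := mem_avg_integral hab hint (P := o.P) (fun u hu ↦ (hstep u hu).1)
        rw [intervalIntegral.integral_const_mul, hba, one_div, inv_inv] at hm
        exact_mod_cast hm
      · rw [sR, mul_add, mul_add]
        push_cast
        refine add_le_add i2 ?_
        have hint : IntervalIntegrable (fun u ↦ tauN N * fR N u) volume a b := (ii_fR N ha hab.le).const_mul _
        have hlo := lo_le_integral hab.le hint (lo := (o.ir : ℝ) * ((2 * KU : ℕ) : ℝ) / S) (fun u hu ↦ by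
          have := (hstep u hu).2.1
          rw [div_le_iff₀ S_posR]
          rw [mul_div_assoc', le_div_iff₀ hK2] at this
          linarith)
        rw [intervalIntegral.integral_const_mul] at hlo
        rw [hba] at hlo
        have e : 1 / ((2 * KU : ℕ) : ℝ) * ((o.ir : ℝ) * ((2 * KU : ℕ) : ℝ) / S) = (o.ir : ℝ) / S := by field_simp
        rw [e, div_le_iff₀ S_posR] at hlo
        linarith
      · rw [sGB, mul_add, mul_add]
        push_cast
        refine add_le_add i3 ?_
        have hint : IntervalIntegrable (fun u ↦ tauN N * gB N u) volume a b := (ii_gB hN ha hab.le).const_mul _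
        have hhi := integral_le_hi hab.le hint (hi := (o.ieb : ℝ) * ((2 * KU : ℕ) : ℝ) / S) (fun u hu ↦ by
          have := (hstep u hu).2.2.1
          rw [le_div_iff₀ S_posR]
          rw [mul_div_assoc', div_le_iff₀ hK2] at this
          linarith)
        rw [intervalIntegral.integral_const_mul] at hhi
        rw [hba] at hhi
        have e : 1 / ((2 * KU : ℕ) : ℝ) * ((o.ieb : ℝ) * ((2 * KU : ℕ) : ℝ) / S) = (o.ieb : ℝ) / S := by field_simp
        rw [e, le_div_iff₀ S_posR] at hhi
        linarith
      · rw [sGR, mul_add, mul_add]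
        push_cast
        refine add_le_add i4 ?_
        have hint : IntervalIntegrable (fun u ↦ tauN N * gR N u) volume a b := (ii_gR hN ha hab.le).const_mul _
        have hhi := integral_le_hi hab.le hint (hi := (o.ier : ℝ) * ((2 * KU : ℕ) : ℝ) / S) (fun u hu ↦ by
          have := (hstep u hu).2.2.2
          rw [le_div_iff₀ S_posR]
          rw [mul_div_assoc', div_le_iff₀ hK2] at this
          linarith)
        rw [intervalIntegral.integral_const_mul] at hhi
        rw [hba] at hhi
        have e : 1 / ((2 * KU : ℕ) : ℝ) * ((o.ier : ℝ) * ((2 * KU : ℕ) : ℝ) / S) = (o.ier : ℝ) / S := by field_simp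
        rw [e, le_div_iff₀ S_posR] at hhi
        linarith
    · simp at h

end Step

/-! ## The scalar terms -/

section Scalars

variable {c : Cell} {N : ℕ}

/-- `√N = e^{L/2}`. [folklore] -/
theorem sqrt_eq_exp_half (hN : 360000 ≤ N) : Real.sqrt N = Real.exp (Real.log N / 2) := by
  have hN0 : (0 : ℝ) < N := by exact_mod_cast (by omega : 0 < N)
  rw [Real.exp_half, Real.exp_log hN0]

/-- **`mSqrtLo` is a valid lower bound for `⌊√N⌋`.** [folklore] -/
theorem mSqrtLo_spec (hN : 360000 ≤ N) (hok : c.ok = true) (hL1 : (c.n1 : ℝ) ≤ c.d * Real.log N)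
    {Mlo : ℕ} (h : mSqrtLo c = some Mlo) : 600 ≤ Mlo ∧ Mlo ≤ Nat.sqrt N := by
  obtain ⟨E, hE, rfl⟩ := Option.map_eq_some_iff.1 h
  refine ⟨le_max_left _ _, max_le (sqrt_ge hN) ?_⟩
  have hL := L_pos hok hL1
  have hL1' := L1_le hok hL1
  have hd := d_pos hok
  set M := Nat.sqrt N with hM
  -- `E ∋ e^{v'}` with `v' ≤ L/2`
  have hv : ∃ v' : ℝ, v' ≤ Real.log N / 2 ∧ MI.mem S (Real.exp v') E := by
    by_cases hc : c.n1 ≤ 120 * c.d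
    · rw [if_pos hc] at hE
      set F := fracSpan c.n1 (2 * c.d) c.n1 (2 * c.d) with hF
      have hmemF : MI.mem S ((c.n1 : ℝ) / ((2 * c.d : ℕ) : ℝ)) F :=
        mem_fracSpan (by have := d_posN hok; omega) (by have := d_posN hok; omega) le_rfl le_rfl
      refine ⟨(F.lo : ℝ) / S, ?_, MI.mem_exp S_pos hE (MI.mem_lower S_pos F)⟩
      rw [div_le_iff₀ S_posR]
      refine hmemF.1.trans (mul_le_mul_of_nonneg_right ?_ S_posR.le)
      push_cast
      rw [div_le_div_iff₀ (by positivity) (by norm_num)]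
      rw [div_le_iff₀ hd] at hL1'
      nlinarith
    · rw [if_neg hc] at hE
      refine ⟨60, ?_, by simpa using MI.mem_exp S_pos hE (MI.mem_ofInt S 60)⟩
      rw [not_le] at hc
      have : (120 : ℝ) * c.d < c.n1 := by exact_mod_cast hc
      rw [div_le_iff₀ hd] at hL1'
      nlinarith
  obtain ⟨v', hv', hmem⟩ := hv
  have h1 : (E.lo : ℝ) ≤ Real.exp v' * S := hmem.1
  have h2 : Real.exp v' < (M : ℝ) + 1 := by
    calc Real.exp v' ≤ Real.exp (Real.log N / 2) := Real.exp_le_exp.2 hv'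
      _ = Real.sqrt N := (sqrt_eq_exp_half hN).symm
      _ < (M : ℝ) + 1 := by
          have h3 : (N : ℝ) < ((M : ℝ) + 1) ^ 2 := by exact_mod_cast Nat.lt_succ_sqrt' N
          calc Real.sqrt N < Real.sqrt (((M : ℝ) + 1) ^ 2) := Real.sqrt_lt_sqrt (Nat.cast_nonneg _) h3
            _ = (M : ℝ) + 1 := Real.sqrt_sq (by positivity)
  set Em := max E.lo 0 with hEm
  have hEm0 : 0 ≤ Em := le_max_right _ _
  have hEmR : (Em : ℝ) < ((M : ℝ) + 1) * S := by
    rw [hEm]; push_cast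
    refine max_lt (lt_of_le_of_lt h1 ?_) (mul_pos (by positivity) S_posR)
    exact mul_lt_mul_of_pos_right h2 S_posR
  have hcast : ((Em.toNat : ℕ) : ℝ) = (Em : ℝ) := by
    have : ((Em.toNat : ℕ) : ℤ) = Em := Int.toNat_of_nonneg hEm0
    exact_mod_cast this
  have hlt : Em.toNat < (M + 1) * S := by
    have : ((Em.toNat : ℕ) : ℝ) < (((M + 1) * S : ℕ) : ℝ) := by rw [hcast]; push_cast; exact hEmR
    exact_mod_cast this
  have hdiv : Em.toNat / S < M + 1 := (Nat.div_lt_iff_lt_mul S_pos).2 hlt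
  omega

/-- The bracket of the `δ`-terms as a real function of `(w, c, M)`. [folklore] -/
def br (w cv M : ℝ) : ℝ :=
  (cv * w / 2 + w ^ 2) * 1000000 / (249001 * M ^ 2) + (cv * w * 1000 / 499 + w ^ 2 * 1000000 / 249001) / M

/-- `br ≥ 0`. [folklore] -/
theorem br_nonneg {w cv M : ℝ} (hw : 0 ≤ w) (hcv : 0 ≤ cv) (hM : 0 < M) : 0 ≤ br w cv M := by
  unfold br; positivity

/-- **`deltaBracket` encloses `br`.** [folklore] -/
theorem mem_deltaBracket {w cv : ℝ} {W C : MI} (hw : MI.mem S w W) (hc : MI.mem S cv C) {Mlo : ℕ}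
    (hM : 0 < Mlo) : MI.mem S (br w cv Mlo) (deltaBracket W C Mlo) := by
  unfold deltaBracket
  have hcw := MI.mem_mul S_pos hc hw
  have hw2 := MI.mem_sqr S_pos hw
  have h1 := MI.mem_divNat (MI.mem_mulInt (MI.mem_add (MI.mem_divNat hcw (by norm_num : 0 < 2)) hw2) 1000000)
    (Nat.mul_pos (by norm_num : 0 < 249001) (pow_pos hM 2))
  have h2 := MI.mem_divNat (MI.mem_add (MI.mem_divNat (MI.mem_mulInt hcw 1000) (by norm_num : 0 < 499))
    (MI.mem_divNat (MI.mem_mulInt hw2 1000000) (by norm_num : 0 < 249001))) hM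
  have h := MI.mem_add h1 h2
  convert h using 1
  unfold br
  push_cast
  ring

/-- The analytic bracket equals `br (1/L) c M`. [folklore] -/
theorem bracket_eq_br {L cv M : ℝ} (hL : 0 < L) (hM : 0 < M) :
    (cv * (L / 2) + 1) / (M ^ 2 * (0.499 * L) ^ 2) + (cv / (0.499 * L) + 1 / (0.499 * L) ^ 2) / M =
      br (1 / L) cv M := by
  unfold br
  field_simp
  ring

/-- `br` is monotone in `w` and antitone in `M`. [folklore] -/
theorem br_mono {w w' cv M M' : ℝ} (hcv : 0 ≤ cv) (hw0 : 0 ≤ w) (hw : w ≤ w') (hM' : 0 < M')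
    (hM : M' ≤ M) : br w cv M ≤ br w' cv M' := by
  unfold br
  have hw'0 : 0 ≤ w' := hw0.trans hw
  have hw2 : w ^ 2 ≤ w' ^ 2 := pow_le_pow_left₀ hw0 hw 2
  have hcw : cv * w ≤ cv * w' := mul_le_mul_of_nonneg_left hw hcv
  have hM0 : 0 < M := lt_of_lt_of_le hM' hM
  refine add_le_add ?_ ?_
  · refine div_le_div₀ (by positivity) (by nlinarith) (by positivity) ?_
    nlinarith
  · exact div_le_div₀ (by positivity) (by nlinarith) hM' hM

/-- **`tDelta` bounds `τ · deltaB` / `τ · deltaR`.** [folklore] -/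
theorem tDelta_spec (hN : 360000 ≤ N) (hok : c.ok = true) (hL1 : (c.n1 : ℝ) ≤ c.d * Real.log N)
    {T : MI} (hT : MI.mem S (tauN N) T) {C : MI} {cv : ℝ} (hcv0 : 0 ≤ cv) (hC : MI.mem S cv C)
    {Mlo : ℕ} (hMlo600 : 600 ≤ Mlo) (hMlo : Mlo ≤ Nat.sqrt N) :
    (tauN N + shiftX / 2) / 2 * ((cv * (Real.log N / 2) + 1) / ((Nat.sqrt N : ℝ) ^ 2 * (0.499 * Real.log N) ^ 2) +
      (cv / (0.499 * Real.log N) + 1 / (0.499 * Real.log N) ^ 2) / Nat.sqrt N) * S ≤ tDelta c T C Mlo := by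
  have hL := L_pos hok hL1
  have hτ := tauN_pos hN
  have hM : 0 < Nat.sqrt N := by have := sqrt_ge hN; omega
  have hMR : (0 : ℝ) < Nat.sqrt N := by exact_mod_cast hM
  have hMloR : (0 : ℝ) < Mlo := by exact_mod_cast (show 0 < Mlo by omega)
  rw [bracket_eq_br hL hMR]
  have hw0 : 0 ≤ 1 / Real.log N := div_nonneg zero_le_one hL.le
  have hmono := br_mono hcv0 hw0 (w_le hok hL1) hMloR (show (Mlo : ℝ) ≤ (Nat.sqrt N : ℝ) by exact_mod_cast hMlo)
  have hbr0 : 0 ≤ br (1 / Real.log N) cv (Nat.sqrt N) := br_nonneg hw0 hcv0 hMR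
  have hw2 : MI.mem S ((c.d : ℝ) / c.n1) (fracSpan c.d c.n1 c.d c.n1) := mem_fracSpan (n1_posN hok) (n1_posN hok) le_rfl le_rfl
  have hmem := mem_deltaBracket hw2 hC (by omega : 0 < Mlo)
  -- the factor `(τ + X/2)/2 ≤ (T.hi/S + 29/8)/2`
  have hf : MI.mem S (((T.hi : ℝ) / S + (29 : ℕ) / (8 : ℕ)) / (2 : ℕ)) (((MI.upper T).add (fracSpan 29 8 29 8)).divNat 2) :=
    MI.mem_divNat (MI.mem_add (MI.mem_upper S_pos T) (mem_fracSpan (p := 29) (q := 8) (p' := 29) (q' := 8)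
      (by norm_num) (by norm_num) le_rfl le_rfl)) (by norm_num : 0 < 2)
  have hτle : tauN N ≤ (T.hi : ℝ) / S := MI.le_hi_div S_pos hT
  have hprod := MI.mem_mul S_pos hf hmem
  unfold tDelta
  refine le_trans ?_ hprod.2
  refine mul_le_mul_of_nonneg_right ?_ S_posR.le
  have hX : shiftX = 29 / 4 := rfl
  have hpos : (0 : ℝ) ≤ (T.hi : ℝ) / S := hτ.le.trans hτle
  refine mul_le_mul ?_ hmono hbr0 (div_nonneg (by push_cast; linarith) (by positivity))
  rw [hX]; push_cast; linarith

/-- **`tBdry` bounds `τ · bdry`.** [folklore] -/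
theorem tBdry_spec (hN : 360000 ≤ N) (hok : c.ok = true) (hL1 : (c.n1 : ℝ) ≤ c.d * Real.log N)
    (hL2 : c.n2 ≠ 0 → (c.d : ℝ) * Real.log N ≤ c.n2) {piI : MI} (hpi : MI.mem S Real.pi piI)
    {T : MI} (hT : MI.mem S (tauN N) T) {d0 : MC} (hd0 : MC.mem S ((tauN N : ℂ) * emConst (sN N)) d0)
    {tb : ℤ} (h : tBdry piI c T d0 = some tb) : tauN N * bdry N * S ≤ tb := by
  have hL := L_pos hok hL1
  have hL1' := L1_le hok hL1
  have hd := d_pos hok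
  have hn := n1_pos hok
  have hτ := tauN_pos hN
  have hN0 : (0 : ℝ) < N := by exact_mod_cast (by omega : 0 < N)
  have hL125 := L1_ge hok
  obtain ⟨hM600R, hlogM, _⟩ := sqrt_facts hN
  obtain ⟨hlogMge, _⟩ := log_sqrt_ge hN
  set M := Nat.sqrt N with hM
  have hM0 : (0 : ℝ) < M := by linarith
  unfold tBdry at h
  split at h
  · rename_i etaN etaM hetaN hetaM
    simp only [Option.some.injEq] at h
    subst h
    -- `η_N`
    have hvN : MI.mem S ((c.n1 : ℝ) / c.d) (fracSpan c.n1 c.d c.n1 c.d) := mem_fracSpan (d_posN hok) (d_posN hok) le_rfl le_rfl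
    have hηN : thetaEnv N / N * S ≤ etaN := by
      refine etaHat_spec hpi hetaN hvN (by linarith) ?_ ?_
      · calc Real.exp ((c.n1 : ℝ) / c.d) ≤ Real.exp (Real.log N) := Real.exp_le_exp.2 hL1'
          _ = N := Real.exp_log hN0
      · intro hbz
        obtain ⟨hn2, hle⟩ := of_decide_eq_true hbz
        have hL2' := L_le_L2 hok hL2 (by omega)
        have h16 : (c.n2 : ℝ) / c.d ≤ 16 := by
          rw [div_le_iff₀ hd]; exact_mod_cast hle
        calc (N : ℝ) = Real.exp (Real.log N) := (Real.exp_log hN0).symm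
          _ ≤ Real.exp 16 := Real.exp_le_exp.2 (hL2'.trans h16)
          _ ≤ thetaZ := exp_sixteen_le_thetaZ
    -- `η_M`
    have hvM : MI.mem S ((c.n1 : ℝ) / ((2 * c.d : ℕ) : ℝ) - (1 : ℕ) / (600 : ℕ))
        ((fracSpan c.n1 (2 * c.d) c.n1 (2 * c.d)).sub (fracSpan 1 600 1 600)) :=
      MI.mem_sub (mem_fracSpan (by have := d_posN hok; omega) (by have := d_posN hok; omega) le_rfl le_rfl)
        (mem_fracSpan (p := 1) (q := 600) (p' := 1) (q' := 600) (by norm_num) (by norm_num) le_rfl le_rfl)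
    have hv2 : (c.n1 : ℝ) / ((2 * c.d : ℕ) : ℝ) = (c.n1 : ℝ) / c.d / 2 := by push_cast; ring
    have hηM : thetaEnv M / M * S ≤ etaM := by
      refine etaHat_spec hpi hetaM hvM ?_ ?_ ?_
      · rw [hv2]; push_cast; linarith
      · refine le_trans (Real.exp_le_exp.2 ?_) (le_of_eq (Real.exp_log hM0))
        rw [hv2]
        have h600 : 1 / (M : ℝ) ≤ 1 / 600 := one_div_le_one_div_of_le (by norm_num) hM600R
        push_cast
        linarith
      · intro hbz
        obtain ⟨hn2, hle⟩ := of_decide_eq_true hbz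
        have hL2' := L_le_L2 hok hL2 (by omega)
        have h32 : (c.n2 : ℝ) / c.d ≤ 32 := by rw [div_le_iff₀ hd]; exact_mod_cast hle
        calc (M : ℝ) = Real.exp (Real.log M) := (Real.exp_log hM0).symm
          _ ≤ Real.exp 16 := Real.exp_le_exp.2 (by linarith)
          _ ≤ thetaZ := exp_sixteen_le_thetaZ
    set etaN' := max etaN 0 with hetaN'
    set etaM' := max etaM 0 with hetaM'
    have hηN' : thetaEnv N / N ≤ (etaN' : ℝ) / S := by
      rw [le_div_iff₀ S_posR]; exact hηN.trans (by rw [hetaN']; exact_mod_cast le_max_left _ _)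
    have hηM' : thetaEnv M / M ≤ (etaM' : ℝ) / S := by
      rw [le_div_iff₀ S_posR]; exact hηM.trans (by rw [hetaM']; exact_mod_cast le_max_left _ _)
    have hetaN'0 : (0 : ℝ) ≤ etaN' := by rw [hetaN']; exact_mod_cast le_max_right _ _
    have hetaM'0 : (0 : ℝ) ≤ etaM' := by rw [hetaM']; exact_mod_cast le_max_right _ _
    set dn := normHi d0 with hdn
    have hdd : ‖(tauN N : ℂ) * emConst (sN N)‖ ≤ (dn : ℝ) / S := by
      rw [le_div_iff₀ S_posR]; exact norm_le_normHi hd0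
    have hmain := tau_mul_bdry_le hN hηN' hηM' hdd
    set th := max T.hi 0 with hth
    have hτth : tauN N * S ≤ (th : ℝ) := le_maxhi_of_mem hT
    have hth0 : (0 : ℝ) ≤ th := le_trans (by positivity) hτth
    have hw := w_le hok hL1
    have hnd : (c.n1 : ℝ) / Real.log N ≤ c.d := by rw [div_le_iff₀ hL]; linarith
    have hS := S_neR
    push_cast
    refine le_trans (mul_le_mul_of_nonneg_right hmain S_posR.le) ?_
    rw [add_mul]
    refine add_le_add ?_ ?_
    · refine le_cdiv_of_le_div (by exact_mod_cast mul_pos S_pos (n1_posN hok)) ?_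
      push_cast
      rw [le_div_iff₀ (mul_pos S_posR hn)]
      calc tauN N * ((etaN' : ℝ) / S) / Real.log N * S * (S * c.n1)
          = (tauN N * S) * etaN' * (c.n1 / Real.log N) := by field_simp
        _ ≤ th * etaN' * c.d :=
            mul_le_mul (mul_le_mul_of_nonneg_right hτth hetaN'0) hnd (by positivity) (by positivity)
    · refine le_cdiv_of_le_div (by exact_mod_cast mul_pos S_pos (n1_posN hok)) ?_
      push_cast
      rw [le_div_iff₀ (mul_pos S_posR hn)]
      have h1000 : tauN N / 1000 * S ≤ ((Numerics.cdiv th 1000 : ℤ) : ℝ) := by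
        refine le_cdiv_of_le_div (by norm_num) ?_
        push_cast; rw [le_div_iff₀ (by norm_num)]; linarith
      have hc0 : (0 : ℝ) ≤ ((Numerics.cdiv th 1000 : ℤ) : ℝ) := le_trans (by positivity) h1000
      calc (etaM' : ℝ) / S * (2 + dn / S + tauN N / 1000) * (2 / Real.log N) * S * (S * c.n1)
          = etaM' * ((2 * S + dn + tauN N / 1000 * S)) * (2 * (c.n1 / Real.log N)) := by field_simp
        _ ≤ etaM' * (2 * S + dn + ((Numerics.cdiv th 1000 : ℤ) : ℝ)) * (2 * c.d) := by
            refine mul_le_mul (mul_le_mul_of_nonneg_left ?_ hetaM'0) ?_ (by positivity) (by positivity)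
            · linarith
            · linarith
        _ = _ := by ring
  · simp at h

/-- `0 < J.lo` for a successful `divPos`. [folklore] -/
theorem divPos_lo_pos {I J K : MI} (h : MI.divPos S I J = some K) : 0 < J.lo := by
  by_contra hJ
  rw [MI.divPos, if_neg hJ] at h
  simp at h

/-- `log 100 ≤ 4.7`. [folklore] -/
theorem log_MJ_le : Real.log MJ ≤ 47 / 10 := by
  have hMJ : ((MJ : ℕ) : ℝ) = 100 := by norm_num [MJ]
  rw [hMJ, Real.log_le_iff_le_exp (by norm_num)]
  have h1 : Real.exp (47 / 10) = Real.exp 1 ^ 4 * Real.exp (7 / 10) := by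
    rw [← Real.exp_nat_mul, ← Real.exp_add]; norm_num
  rw [h1]
  have h2 : (2.7182818283 : ℝ) ^ 4 ≤ Real.exp 1 ^ 4 := pow_le_pow_left₀ (by norm_num) Real.exp_one_gt_d9.le 4
  have h3 : 1 + (7 / 10 : ℝ) + (7 / 10) ^ 2 / 2 ≤ Real.exp (7 / 10) := Real.quadratic_le_exp_of_nonneg (by norm_num)
  nlinarith [Real.exp_pos (7 / 10 : ℝ)]

/-- **`jTermHi` bounds the `m`-th term of `τ · Jsum`.** [folklore] -/
theorem jTermHi_spec (hN : 360000 ≤ N) (hok : c.ok = true) (hL1 : (c.n1 : ℝ) ≤ c.d * Real.log N)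
    (hL2 : c.n2 ≠ 0 → (c.d : ℝ) * Real.log N ≤ c.n2) {piI : MI} (hpi : MI.mem S Real.pi piI)
    {m : ℕ} (hm : 2 ≤ m) {z : ℤ} (h : jTermHi piI c m = some z) :
    thetaEnv ((N : ℝ) / m) / ((N : ℝ) / m) *
      (shiftX * (1 / Real.log N) ^ 2 / ((1 - (1 / Real.log N) * Real.log m) * m)) * S ≤ z := by
  have hL := L_pos hok hL1
  have hL1' := L1_le hok hL1
  have hd := d_pos hok
  have hn := n1_pos hok
  have hN0 : (0 : ℝ) < N := by exact_mod_cast (by omega : 0 < N)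
  have hm0 : (0 : ℝ) < m := by exact_mod_cast (by omega : 0 < m)
  have hw := w_le hok hL1
  unfold jTermHi at h
  split at h
  · simp at h
  rename_i Lm hLm'
  have hLm := MI.mem_logNat S_pos hLm'
  by_cases hV : ((fracSpan c.n1 c.d c.n1 c.d).sub Lm).lo < 4 * (S : ℤ)
  · rw [if_pos hV] at h; simp at h
  rw [if_neg hV] at h
  split at h
  · rename_i eta q heta hq
    simp only [Option.some.injEq] at h
    subst h
    have hlogm0 : 0 ≤ Real.log m := Real.log_nonneg (by exact_mod_cast (by omega : 1 ≤ m))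
    -- the envelope factor
    have hv := MI.mem_sub (mem_fracSpan (p := c.n1) (q := c.d) (p' := c.n1) (q' := c.d) (d_posN hok) (d_posN hok) le_rfl le_rfl) hLm
    have hv4 : 4 ≤ (c.n1 : ℝ) / c.d - Real.log m := by
      rw [not_lt] at hV
      have h1 := hv.1
      have h2 : ((4 * (S : ℤ) : ℤ) : ℝ) ≤ (((fracSpan c.n1 c.d c.n1 c.d).sub Lm).lo : ℝ) := by exact_mod_cast hV
      push_cast at h2
      nlinarith [S_posR]
    have hNm : Real.exp (Real.log N - Real.log m) = (N : ℝ) / m := by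
      rw [Real.exp_sub, Real.exp_log hN0, Real.exp_log hm0]
    have hη : thetaEnv ((N : ℝ) / m) / ((N : ℝ) / m) * S ≤ eta := by
      refine etaHat_spec hpi heta hv hv4 ?_ ?_
      · rw [← hNm]; exact Real.exp_le_exp.2 (by linarith)
      · intro hbz
        obtain ⟨hn2, hle⟩ := of_decide_eq_true hbz
        have hL2' := L_le_L2 hok hL2 (by omega)
        have hle' : (c.n2 : ℝ) * S ≤ (16 * S + Lm.lo) * c.d := by exact_mod_cast hle
        have h16 : (c.n2 : ℝ) / c.d ≤ 16 + Real.log m := by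
          rw [div_le_iff₀ hd]
          have := hLm.1
          nlinarith [S_posR]
        rw [← hNm]
        calc Real.exp (Real.log N - Real.log m) ≤ Real.exp 16 := Real.exp_le_exp.2 (by linarith)
          _ ≤ thetaZ := exp_sixteen_le_thetaZ
    -- the coefficient
    have hw2 : MI.mem S ((c.d : ℝ) / c.n1) (fracSpan c.d c.n1 c.d c.n1) := mem_fracSpan (n1_posN hok) (n1_posN hok) le_rfl le_rfl
    have hnum : MI.mem S (shiftX * ((c.d : ℝ) / c.n1) ^ 2) (((MI.sqr S (fracSpan c.d c.n1 c.d c.n1)).mulInt 29).divNat 4) := by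
      have := MI.mem_divNat (MI.mem_mulInt (MI.mem_sqr S_pos hw2) 29) (by norm_num : 0 < 4)
      convert this using 1; unfold shiftX; push_cast; ring
    have hden : MI.mem S ((1 - (c.d : ℝ) / c.n1 * Real.log m) * m)
        (((MI.ofInt S 1).sub (MI.mul S (fracSpan c.d c.n1 c.d c.n1) Lm)).mulInt m) := by
      have := MI.mem_mulInt (MI.mem_sub (MI.mem_ofInt S 1) (MI.mem_mul S_pos hw2 hLm)) m
      convert this using 1; push_cast; ring
    have hq' := MI.mem_divPos S_pos hq hnum hden
    have hdenpos : 0 < (1 - (c.d : ℝ) / c.n1 * Real.log m) * m := by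
      have h1 := divPos_lo_pos hq
      have h2 := hden.1
      have h3 : (0 : ℝ) < ((((MI.ofInt S 1).sub (MI.mul S (fracSpan c.d c.n1 c.d c.n1) Lm)).mulInt m).lo : ℝ) := by
        exact_mod_cast h1
      nlinarith [S_posR]
    have hden1 : 0 < 1 - (c.d : ℝ) / c.n1 * Real.log m := by
      rcases (mul_pos_iff.1 hdenpos) with ⟨h1, _⟩ | ⟨_, h2⟩
      · exact h1
      · linarith
    have hcoef : shiftX * (1 / Real.log N) ^ 2 / ((1 - (1 / Real.log N) * Real.log m) * m) ≤
        shiftX * ((c.d : ℝ) / c.n1) ^ 2 / ((1 - (c.d : ℝ) / c.n1 * Real.log m) * m) := by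
      have hX : (0 : ℝ) < shiftX := by norm_num [shiftX]
      refine div_le_div₀ (by positivity) ?_ hdenpos ?_
      · exact mul_le_mul_of_nonneg_left (pow_le_pow_left₀ (by positivity) hw 2) hX.le
      · refine mul_le_mul_of_nonneg_right ?_ hm0.le
        nlinarith [mul_le_mul_of_nonneg_right hw hlogm0]
    have hcoefq : shiftX * (1 / Real.log N) ^ 2 / ((1 - (1 / Real.log N) * Real.log m) * m) * S ≤ ((max q.hi 0 : ℤ) : ℝ) :=
      (mul_le_mul_of_nonneg_right hcoef S_posR.le).trans (le_maxhi_of_mem hq')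
    have hθ0 : 0 ≤ thetaEnv ((N : ℝ) / m) / ((N : ℝ) / m) := by
      refine div_nonneg (thetaEnv_nonneg ?_) (by positivity)
      rw [← hNm]; exact Real.one_le_exp (by linarith)
    have hηq : thetaEnv ((N : ℝ) / m) / ((N : ℝ) / m) * S ≤ ((max eta 0 : ℤ) : ℝ) :=
      hη.trans (by exact_mod_cast le_max_left _ _)
    have hq0 : (0 : ℝ) ≤ ((max q.hi 0 : ℤ) : ℝ) := by exact_mod_cast le_max_right _ _
    have hcoef0 : 0 ≤ shiftX * (1 / Real.log N) ^ 2 / ((1 - (1 / Real.log N) * Real.log m) * m) * S := by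
      have hX : (0 : ℝ) < shiftX := by norm_num [shiftX]
      have : 0 < 1 - (1 / Real.log N) * Real.log m := by nlinarith [mul_le_mul_of_nonneg_right hw hlogm0]
      positivity
    refine le_cdiv_of_le_div S_posZ ?_
    push_cast
    rw [le_div_iff₀ S_posR]
    calc thetaEnv ((N : ℝ) / m) / ((N : ℝ) / m) * (shiftX * (1 / Real.log N) ^ 2 / ((1 - (1 / Real.log N) * Real.log m) * m)) * S * S
        = (thetaEnv ((N : ℝ) / m) / ((N : ℝ) / m) * S) * (shiftX * (1 / Real.log N) ^ 2 / ((1 - (1 / Real.log N) * Real.log m) * m) * S) := by ring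
      _ ≤ ((max eta 0 : ℤ) : ℝ) * ((max q.hi 0 : ℤ) : ℝ) :=
          mul_le_mul hηq hcoefq hcoef0 (le_trans (by positivity) hηq)
      _ = _ := by push_cast; ring
  · simp at h

/-- **`tJsmall` bounds the finite part of `τ · Jsum`.** [folklore] -/
theorem tJsmall_spec (hN : 360000 ≤ N) (hok : c.ok = true) (hL1 : (c.n1 : ℝ) ≤ c.d * Real.log N)
    (hL2 : c.n2 ≠ 0 → (c.d : ℝ) * Real.log N ≤ c.n2) {piI : MI} (hpi : MI.mem S Real.pi piI) :
    ∀ (n : ℕ) {z : ℤ}, tJsmall piI c n = some z →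
      (∑ m ∈ Finset.Icc 2 (n + 1), thetaEnv ((N : ℝ) / m) / ((N : ℝ) / m) *
        (shiftX * (1 / Real.log N) ^ 2 / ((1 - (1 / Real.log N) * Real.log m) * m))) * S ≤ (z : ℝ) := by
  intro n
  induction n with
  | zero =>
    intro z h
    simp only [tJsmall, Option.some.injEq] at h
    subst h
    simp
  | succ n ih =>
    intro z h
    simp only [tJsmall] at h
    split at h
    · rename_i acc t hacc ht
      simp only [Option.some.injEq] at h
      subst h
      rw [Finset.sum_Icc_succ_top (by omega : 2 ≤ n + 1 + 1), add_mul, Int.cast_add]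
      exact add_le_add (ih hacc) (jTermHi_spec hN hok hL1 hL2 hpi (by omega) ht)
    · simp at h

/-- **`logTailHi` bounds `log (2 (1 − w log MJ))` from above** (and is `≥ 0`). [folklore] -/
theorem logTailHi_spec (hok : c.ok = true) (hL1 : (c.n1 : ℝ) ≤ c.d * Real.log N)
    (hL2 : c.n2 ≠ 0 → (c.d : ℝ) * Real.log N ≤ c.n2) {U : ℤ} (h : logTailHi c = some U) :
    (0 : ℝ) ≤ U ∧ Real.log (2 * (1 - (1 / Real.log N) * Real.log MJ)) * S ≤ U := by
  have hL := L_pos hok hL1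
  have hL125 := L_ge hok hL1
  have hd := d_pos hok
  unfold logTailHi at h
  split at h
  · rename_i LmJ L2 hLmJ' hL2'
    split at h
    · rename_i LOS hLOS
      simp only [Option.some.injEq] at h
      subst h
      refine ⟨(show ((0 : ℤ) : ℝ) ≤ ((max (L2.hi + LOS.hi) 0 : ℤ) : ℝ) by exact_mod_cast le_max_right _ _) |>.trans_eq' (by simp),
        le_trans ?_ (show ((L2.hi + LOS.hi : ℤ) : ℝ) ≤ ((max (L2.hi + LOS.hi) 0 : ℤ) : ℝ) by
          exact_mod_cast le_max_left _ _)⟩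
      have hLmJ := MI.mem_logNat S_pos hLmJ'
      have hlog2 := MI.mem_logTwo S_pos hL2'
      have hℓ0 : 0 ≤ Real.log MJ := Real.log_nonneg (by norm_num [MJ])
      have hℓ := log_MJ_le
      set w := 1 / Real.log N with hw
      have hw0 : 0 ≤ w := by positivity
      have hwle : w ≤ 2 / 25 := by rw [hw, div_le_div_iff₀ hL (by norm_num)]; linarith
      have hpos : 0 < 1 - w * Real.log MJ := by nlinarith
      set xlo : ℤ := if c.n2 = 0 then 0 else (c.d : ℤ) * max LmJ.lo 0 / c.n2 with hxlo
      have hx : (xlo : ℝ) / S ≤ w * Real.log MJ := by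
        rw [hxlo]
        split_ifs with hn2
        · simp; positivity
        · have hL2le := L_le_L2 hok hL2 hn2
          have hn2pos : (0 : ℝ) < c.n2 := by exact_mod_cast Nat.pos_of_ne_zero hn2
          rw [div_le_iff₀ S_posR]
          refine fdiv_le_of_le_mul (by exact_mod_cast Nat.pos_of_ne_zero hn2) ?_
          push_cast
          have hmax : max (LmJ.lo : ℝ) 0 ≤ Real.log MJ * S := max_le hLmJ.1 (by positivity)
          have hdL : (c.d : ℝ) * Real.log N ≤ c.n2 := hL2 hn2
          have hw1 : (c.d : ℝ) ≤ w * c.n2 := by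
            rw [hw, div_mul_eq_mul_div, le_div_iff₀ hL, one_mul]; linarith
          calc (c.d : ℝ) * max (LmJ.lo : ℝ) 0 ≤ (c.d : ℝ) * (Real.log MJ * S) := mul_le_mul_of_nonneg_left hmax hd.le
            _ ≤ (w * c.n2) * (Real.log MJ * S) := mul_le_mul_of_nonneg_right hw1 (by positivity)
            _ = w * Real.log MJ * S * c.n2 := by ring
      have hxmem : MI.mem S ((xlo : ℝ) / S) (MI.ofScaled xlo) := MI.mem_ofScaled S_pos xlo
      have hlos := MI.mem_logOneSub S_pos hLOS hxmem
      have h1 : Real.log (1 - w * Real.log MJ) ≤ Real.log (1 - (xlo : ℝ) / S) := Real.log_le_log hpos (by linarith)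
      rw [Real.log_mul (by norm_num) hpos.ne', add_mul]
      push_cast
      exact add_le_add hlog2.2 ((mul_le_mul_of_nonneg_right h1 S_posR.le).trans hlos.2)
    · simp at h
  · simp at h

/-- **`tJtail` bounds the tail of `τ · Jsum`.** [folklore] -/
theorem tJtail_spec (hN : 360000 ≤ N) (hok : c.ok = true) (hL1 : (c.n1 : ℝ) ≤ c.d * Real.log N)
    (hL2 : c.n2 ≠ 0 → (c.d : ℝ) * Real.log N ≤ c.n2) {piI : MI} (hpi : MI.mem S Real.pi piI)
    {T : MI} (hT : MI.mem S (tauN N) T) {z : ℤ} (h : tJtail piI c T = some z) :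
    ∃ ηsup : ℝ, (∀ t : ℝ, Real.sqrt N ≤ t → t ≤ N → thetaEnv t / t ≤ ηsup) ∧
      tauN N * ηsup * Real.log (2 * (1 - (1 / Real.log N) * Real.log MJ)) * S ≤ z := by
  have hL := L_pos hok hL1
  have hL1' := L1_le hok hL1
  have hd := d_pos hok
  have hτ := tauN_pos hN
  have hN0 : (0 : ℝ) < N := by exact_mod_cast (by omega : 0 < N)
  have hL125 := L1_ge hok
  unfold tJtail at h
  split at h
  · rename_i etaSup U hetaSup hU
    simp only [Option.some.injEq] at h
    subst h
    obtain ⟨hU0, hUb⟩ := logTailHi_spec hok hL1 hL2 hU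
    set eta' := max etaSup 0 with heta'
    have heta'0 : (0 : ℝ) ≤ eta' := by rw [heta']; exact_mod_cast le_max_right _ _
    refine ⟨(eta' : ℝ) / S, ?_, ?_⟩
    · intro t ht1 ht2
      have hv : MI.mem S ((c.n1 : ℝ) / ((2 * c.d : ℕ) : ℝ)) (fracSpan c.n1 (2 * c.d) c.n1 (2 * c.d)) :=
        mem_fracSpan (by have := d_posN hok; omega) (by have := d_posN hok; omega) le_rfl le_rfl
      have hv2 : (c.n1 : ℝ) / ((2 * c.d : ℕ) : ℝ) = (c.n1 : ℝ) / c.d / 2 := by push_cast; ring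
      have hη : thetaEnv t / t * S ≤ etaSup := by
        refine etaHat_spec hpi hetaSup hv (by rw [hv2]; linarith) ?_ ?_
        · refine le_trans (Real.exp_le_exp.2 ?_) ((sqrt_eq_exp_half hN).symm.le.trans ht1)
          rw [hv2]; linarith
        · intro hbz
          obtain ⟨hn2, hle⟩ := of_decide_eq_true hbz
          have hL2' := L_le_L2 hok hL2 (by omega)
          have h16 : (c.n2 : ℝ) / c.d ≤ 16 := by rw [div_le_iff₀ hd]; exact_mod_cast hle
          calc t ≤ N := ht2
            _ = Real.exp (Real.log N) := (Real.exp_log hN0).symm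
            _ ≤ Real.exp 16 := Real.exp_le_exp.2 (hL2'.trans h16)
            _ ≤ thetaZ := exp_sixteen_le_thetaZ
      rw [le_div_iff₀ S_posR]
      exact hη.trans (by rw [heta']; exact_mod_cast le_max_left _ _)
    · set th := max T.hi 0 with hth
      have hτth : tauN N * S ≤ (th : ℝ) := le_maxhi_of_mem hT
      have hth0 : (0 : ℝ) ≤ th := le_trans (by positivity) hτth
      set ℓ := Real.log (2 * (1 - (1 / Real.log N) * Real.log MJ)) with hℓ
      have hin : (th : ℝ) * eta' / S ≤ ((Numerics.cdiv (th * eta') S : ℤ) : ℝ) := by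
        have := Numerics.div_le_cdiv (a := th * eta') S_posZ
        push_cast at this
        exact this
      have hin0 : (0 : ℝ) ≤ ((Numerics.cdiv (th * eta') S : ℤ) : ℝ) := le_trans (by positivity) hin
      refine le_cdiv_of_le_div S_posZ ?_
      push_cast
      rw [le_div_iff₀ S_posR]
      have hℓU : ℓ * S ≤ U := hUb
      have hkey : tauN N * S * eta' * (ℓ * S) ≤ th * eta' * U := by
        rcases le_or_gt 0 (ℓ * S) with hpos | hneg
        · exact mul_le_mul (mul_le_mul_of_nonneg_right hτth heta'0) hℓU hpos (by positivity)
        · have : tauN N * S * eta' * (ℓ * S) ≤ 0 :=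
            mul_nonpos_of_nonneg_of_nonpos (by positivity) hneg.le
          exact this.trans (by positivity)
      calc tauN N * ((eta' : ℝ) / S) * ℓ * S * S = tauN N * S * eta' * (ℓ * S) / S := by field_simp
        _ ≤ th * eta' * U / S := div_le_div_of_nonneg_right hkey S_posR.le
        _ = (th * eta' / S) * U := by ring
        _ ≤ ((Numerics.cdiv (th * eta') S : ℤ) : ℝ) * U := mul_le_mul_of_nonneg_right hin hU0
  · simp at h

end Scalars

/-! ## The verdict -/

section Final

variable {c : Cell} {N : ℕ}

/-- `X ∈ XI`. [folklore] -/
theorem mem_XI : MI.mem S shiftX XI := by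
  have h := mem_fracSpan (p := 29) (q := 4) (p' := 29) (q' := 4) (by norm_num) (by norm_num) le_rfl le_rfl
  have e : shiftX = ((29 : ℕ) : ℝ) / ((4 : ℕ) : ℝ) := by unfold shiftX; norm_num
  rw [e]; exact h

/-- **The main-term bound**: `τ ‖mainB‖ S ≤ ‖(1 − e^{−iX})(−i) + d0 − IB‖·S + sliver`. [folklore] -/
theorem main_bound (hN : 360000 ≤ N) {piI : MI} (hpi : MI.mem S Real.pi piI) {T : MI}
    (hT : MI.mem S (tauN N) T) {d0 : MC} (hd0 : MC.mem S ((tauN N : ℂ) * emConst (sN N)) d0)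
    {IBs : MC} (hIB : MC.mem S ((((2 * KU : ℕ) : ℝ) : ℂ) * ((tauN N : ℂ) * ∫ u in (1 / 2 : ℝ)..1, fB N u)) IBs)
    {UB0 : ℤ} (h : mainNorm piI d0 IBs = some UB0) {Mlo : ℕ} (hMlo600 : 600 ≤ Mlo) (hMlo : Mlo ≤ Nat.sqrt N) :
    tauN N * ‖mainB N‖ * S ≤ UB0 + Numerics.cdiv (max T.hi 0 * 222) (100 * Mlo) := by
  have hτ := tauN_pos hN
  have hτ0 : (tauN N : ℂ) ≠ 0 := Complex.ofReal_ne_zero.2 hτ.ne'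
  obtain ⟨hlo, hhi, _⟩ := uM_bounds hN
  have huMpos := uM_pos hN
  have hM600 := sqrt_ge hN
  set M := Nat.sqrt N with hM
  have h600 : (600 : ℝ) ≤ M := by exact_mod_cast hM600
  have hM0 : (0 : ℝ) < M := by linarith
  have hMlo0 : (0 : ℝ) < Mlo := by exact_mod_cast (show 0 < Mlo by omega)
  set th := max T.hi 0 with hthdef
  unfold mainNorm at h
  split at h
  · rename_i EX hEX
    simp only [Option.some.injEq] at h
    subst h
    have hE := mem_expNegI hpi hEX mem_XI
    have hK2 := twoKU_posR
    have hIB' : MC.mem S ((tauN N : ℂ) * ∫ u in (1 / 2 : ℝ)..1, fB N u) (IBs.divNat (2 * KU)) := by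
      have := MC.mem_divNat hIB (show 0 < 2 * KU by norm_num [KU])
      convert this using 1
      have hne : ((2 * KU : ℕ) : ℂ) ≠ 0 := by exact_mod_cast (show (2 * KU : ℕ) ≠ 0 by norm_num [KU])
      rw [eq_div_iff hne]
      push_cast
      ring
    set V : ℂ := (1 - Complex.exp (-((shiftX : ℝ) : ℂ) * I)) * (-I) + (tauN N : ℂ) * emConst (sN N) -
      (tauN N : ℂ) * ∫ u in (1 / 2 : ℝ)..1, fB N u with hV
    have hVmem : MC.mem S V (((((MC.ofInt S 1).sub EX).mulNegI).add d0).sub (IBs.divNat (2 * KU))) := by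
      have := MC.mem_sub (MC.mem_add (MC.mem_mulNegI (MC.mem_sub (MC.mem_ofInt S 1) hE)) hd0) hIB'
      simpa [hV] using this
    have hVn := norm_le_normHi hVmem
    -- `τ · mainB = V − τ ∫_{uM}^{½} fB`
    have hsplit : ∫ u in (uM N)..1, fB N u = (∫ u in (uM N)..(1 / 2 : ℝ), fB N u) + ∫ u in (1 / 2 : ℝ)..1, fB N u :=
      (intervalIntegral.integral_add_adjacent_intervals (ii_fB N huMpos hhi) (ii_fB N (by norm_num) (by norm_num))).symm
    have hτmain : (tauN N : ℂ) * mainB N = V - (tauN N : ℂ) * ∫ u in (uM N)..(1 / 2 : ℝ), fB N u := by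
      rw [mainB_eq, hsplit, hV]
      have e1 : (tauN N : ℂ) * ((1 - Complex.exp (-((shiftX : ℝ) : ℂ) * I)) / ((tauN N : ℂ) * I)) =
          (1 - Complex.exp (-((shiftX : ℝ) : ℂ) * I)) * (-I) := by
        rw [mul_div_assoc', div_eq_iff (mul_ne_zero hτ0 Complex.I_ne_zero)]
        ring_nf
        rw [Complex.I_sq]
        ring
      rw [mul_sub, mul_add, e1]
      ring
    have hsliver : ‖∫ u in (uM N)..(1 / 2 : ℝ), fB N u‖ ≤ 2.22 / M := norm_integral_sliver_le hN
    have hnorm : tauN N * ‖mainB N‖ ≤ ‖V‖ + tauN N * (2.22 / M) := by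
      have e : tauN N * ‖mainB N‖ = ‖(tauN N : ℂ) * mainB N‖ := by
        rw [norm_mul, Complex.norm_real, Real.norm_eq_abs, abs_of_pos hτ]
      rw [e, hτmain]
      refine (norm_sub_le _ _).trans (add_le_add le_rfl ?_)
      rw [norm_mul, Complex.norm_real, Real.norm_eq_abs, abs_of_pos hτ]
      exact mul_le_mul_of_nonneg_left hsliver hτ.le
    have hth : tauN N * S ≤ (th : ℝ) := le_maxhi_of_mem hT
    have hth0 : (0 : ℝ) ≤ th := le_trans (by positivity) hth
    have hsl : tauN N * (2.22 / M) * S ≤ ((Numerics.cdiv (th * 222) (100 * Mlo) : ℤ) : ℝ) := by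
      refine le_cdiv_of_le_div (by exact_mod_cast (show (0 : ℤ) < 100 * Mlo by omega)) ?_
      push_cast
      rw [le_div_iff₀ (by positivity)]
      have hMM : (Mlo : ℝ) ≤ M := by exact_mod_cast hMlo
      calc tauN N * (2.22 / M) * S * (100 * (Mlo : ℝ)) = (tauN N * S) * 222 * (Mlo / M) := by
            field_simp; ring
        _ ≤ (th : ℝ) * 222 * 1 :=
            mul_le_mul (mul_le_mul_of_nonneg_right hth (by norm_num)) ((div_le_one hM0).2 hMM)
              (by positivity) (by positivity)
        _ = _ := by ring
    push_cast
    calc tauN N * ‖mainB N‖ * S ≤ (‖V‖ + tauN N * (2.22 / M)) * S := mul_le_mul_of_nonneg_right hnorm S_posR.le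
      _ = ‖V‖ * S + tauN N * (2.22 / M) * S := by ring
      _ ≤ _ := add_le_add hVn hsl
  · simp at h

set_option maxHeartbeats 800000 in
/-- **Soundness of the cell check.** If `checkCell c = true`, then for every `N ≥ 360000` with
`log N ∈ [n1/d, n2/d]` (no upper constraint if `n2 = 0`): `‖Bval N‖ < Rval N`, and the side
condition `2 ‖S(N/p)‖/p < Rval N` for every prime `p ∈ (√N, N]`. [folklore] -/
theorem criterion_of_checkCell (hc : checkCell c = true) (hN : 360000 ≤ N)
    (hL1 : (c.n1 : ℝ) ≤ c.d * Real.log N) (hL2 : c.n2 ≠ 0 → (c.d : ℝ) * Real.log N ≤ c.n2) :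
    ‖Bval N‖ < Rval N ∧ ∀ p ∈ bigPrimes N, 2 * (‖powSum (sN N) (N / p)‖ / p) < Rval N := by
  have hτ := tauN_pos hN
  have hL := log_pos hN
  unfold checkCell at hc
  split at hc
  · rename_i UB LB side hdata
    simp only [Bool.and_eq_true, decide_eq_true_eq] at hc
    obtain ⟨hUL, hside⟩ := hc
    unfold cellData at hdata
    by_cases hok : c.ok = true
    · rw [if_pos hok] at hdata
      split at hdata
      · simp at hdata
      rename_i piI hpi'
      have hpi := MI.mem_pi S hpi'
      split at hdata
      · rename_i d0 tS hd0' htS'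
        split at hdata
        · simp at hdata
        rename_i us hus
        split at hdata
        · rename_i UB0 ub lb side' hmain hscal
          simp only [Option.some.injEq, Prod.mk.injEq] at hdata
          obtain ⟨rfl, rfl, rfl⟩ := hdata
          -- the enclosures
          have hT := mem_tauI hok hL1 hL2
          have hT0 := tauI_lo_nonneg c
          set T := tauI c with hTdef
          have hd0 : MC.mem S ((tauN N : ℂ) * emConst (sN N)) d0 :=
            mem_splitHull (fun T' B hT0' hx hf ↦ mem_d0Box hN hpi hx hT0' hf) DEPTH0 T d0 hT0 hT hd0'
          obtain ⟨htSlen, htSmem⟩ := tSList_spec hpi hT0 (M0 + 1) htS'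
          have htS : ∀ (m : ℕ) (B : MC), tS[m]? = some B → MC.mem S ((tauN N : ℂ) * powSum (sN N) m) B :=
            fun m B h ↦ htSmem m B h (tauN N) hT
          obtain ⟨hIB, hIR, hIEB, hIER⟩ := uSums_spec hN hok hL1 hL2 hpi hT htSlen htS hd0 KU hus le_rfl
          rw [ua_KU] at hIB hIR hIEB hIER
          -- the scalars
          unfold scalars at hscal
          split at hscal
          · rename_i Mlo tb tj1 tj2 hMlo htb htj1 htj2
            simp only [Option.some.injEq, Prod.mk.injEq] at hscal
            obtain ⟨rfl, rfl, rfl⟩ := hscal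
            obtain ⟨hMlo600, hMloM⟩ := mSqrtLo_spec hN hok hL1 hMlo
            set th := max T.hi 0 with hthdef
            have hth : tauN N * S ≤ (th : ℝ) := le_maxhi_of_mem hT
            have hth0 : (0 : ℝ) ≤ th := le_trans (by positivity) hth
            have hM600 := sqrt_ge hN
            set M := Nat.sqrt N with hM
            have hM0 : (0 : ℝ) < M := by have : (600 : ℝ) ≤ M := (by exact_mod_cast hM600); linarith
            have hMloR : (Mlo : ℝ) ≤ M := by exact_mod_cast hMloM
            have hMlo0 : (0 : ℝ) < Mlo := by exact_mod_cast (show 0 < Mlo by omega)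
            have hN0 : (0 : ℝ) < N := by exact_mod_cast (by omega : 0 < N)
            -- (a) main term
            have hA := main_bound hN hpi hT hd0 hIB hmain hMlo600 hMloM
            -- (b) tiny
            have hB : tauN N * tinyB N * S ≤ ((Numerics.cdiv th (Mlo ^ 2) : ℤ) : ℝ) := by
              have h1 := tinyB_le hN
              have hMM : ((M : ℝ)) ^ 2 ≤ N := by exact_mod_cast Nat.sqrt_le' N
              refine le_cdiv_of_le_div (by positivity) ?_
              push_cast
              rw [le_div_iff₀ (by positivity)]
              calc tauN N * tinyB N * S * (Mlo : ℝ) ^ 2 ≤ tauN N * (1 / N) * S * (M : ℝ) ^ 2 := by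
                    gcongr
                _ = (tauN N * S) * ((M : ℝ) ^ 2 / N) := by field_simp
                _ ≤ th * 1 := mul_le_mul hth ((div_le_one hN0).2 hMM) (by positivity) hth0
                _ = th := by ring
            -- (c) delta terms
            have hcv := cHiS_spec hN hT
            have hCB : MI.mem S ‖(1 : ℂ) + tauN N * I‖ ⟨S, cHiS T⟩ := by
              constructor
              · push_cast
                have : (1 : ℝ) ≤ ‖(1 : ℂ) + tauN N * I‖ := by
                  have h1 : ‖(1 : ℂ) + tauN N * I‖ ^ 2 = 1 + tauN N ^ 2 := by
                    rw [Complex.sq_norm, Complex.normSq_apply]; simp; ring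
                  nlinarith [norm_nonneg ((1 : ℂ) + tauN N * I), sq_nonneg (tauN N)]
                nlinarith [S_posR]
              · exact hcv
            have hC := tDelta_spec hN hok hL1 hT (norm_nonneg _) hCB hMlo600 hMloM
            have hCR := tDelta_spec hN hok hL1 hT zero_le_one
              (show MI.mem S (1 : ℝ) (MI.ofInt S 1) by exact_mod_cast MI.mem_ofInt S 1) hMlo600 hMloM
            have hdB := tau_mul_deltaB_le hN
            have hdR := tau_mul_deltaR_le hN
            -- (d) boundary
            have hD := tBdry_spec hN hok hL1 hL2 hpi hT hd0 htb
            -- (e) J-sum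
            have hE : tauN N * Jsum N * S ≤ ((tj1 + tj2 : ℤ) : ℝ) := by
              obtain ⟨ηsup, hsup, htail⟩ := tJtail_spec hN hok hL1 hL2 hpi hT htj2
              have hsmall := tJsmall_spec hN hok hL1 hL2 hpi (MJ - 1) htj1
              have hMJ : MJ - 1 + 1 = MJ := by norm_num [MJ]
              rw [hMJ] at hsmall
              have hJ := tau_mul_Jsum_le hN (mJ := MJ) (by norm_num [MJ]) (by norm_num [MJ])
                (η := fun m ↦ thetaEnv ((N : ℝ) / m) / ((N : ℝ) / m)) (fun m _ ↦ le_rfl) hsup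
              push_cast
              refine le_trans (mul_le_mul_of_nonneg_right hJ S_posR.le) ?_
              rw [add_mul]
              exact add_le_add hsmall htail
            -- (f) the variation integrals and the main `R` integral
            obtain ⟨_, _, hlogM1⟩ := sqrt_facts hN
            obtain ⟨_, huMhalf, _⟩ := uM_bounds hN
            have huMpos := uM_pos hN
            have huM1 : 1 / 2 ≤ uM1 N := by
              unfold uM1; rw [le_div_iff₀ hL]; linarith
            have huM1' := uM1_le_one hN
            have hF : tauN N * errIntB N * S ≤ us.IEB := by
              rw [errIntB_eq]
              have hs : ∫ u in (1 / 2 : ℝ)..1, gB N u = (∫ u in (1 / 2 : ℝ)..(uM1 N), gB N u) + ∫ u in (uM1 N)..1, gB N u :=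
                (intervalIntegral.integral_add_adjacent_intervals (ii_gB hN (by norm_num) huM1)
                  (ii_gB hN (by linarith) huM1')).symm
              have hnn : 0 ≤ ∫ u in (1 / 2 : ℝ)..(uM1 N), gB N u :=
                intervalIntegral.integral_nonneg huM1 fun u hu ↦ (gB_nonneg hN (by linarith [hu.1])).1
              have h1 : tauN N * (∫ u in (uM1 N)..1, gB N u) ≤ tauN N * ∫ u in (1 / 2 : ℝ)..1, gB N u := by
                rw [hs, mul_add]; linarith [mul_nonneg hτ.le hnn]
              calc tauN N * (∫ u in (uM1 N)..1, gB N u) * S = S * (tauN N * ∫ u in (uM1 N)..1, gB N u) := by ring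
                _ ≤ S * (tauN N * ∫ u in (1 / 2 : ℝ)..1, gB N u) := mul_le_mul_of_nonneg_left h1 S_posR.le
                _ ≤ _ := hIEB
            have hG : tauN N * errIntR N * S ≤ us.IER := by
              rw [errIntR_eq]
              have hs : ∫ u in (1 / 2 : ℝ)..1, gR N u = (∫ u in (1 / 2 : ℝ)..(uM1 N), gR N u) + ∫ u in (uM1 N)..1, gR N u :=
                (intervalIntegral.integral_add_adjacent_intervals (ii_gR hN (by norm_num) huM1)
                  (ii_gR hN (by linarith) huM1')).symm
              have hnn : 0 ≤ ∫ u in (1 / 2 : ℝ)..(uM1 N), gR N u :=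
                intervalIntegral.integral_nonneg huM1 fun u hu ↦ (gB_nonneg hN (by linarith [hu.1])).2
              have h1 : tauN N * (∫ u in (uM1 N)..1, gR N u) ≤ tauN N * ∫ u in (1 / 2 : ℝ)..1, gR N u := by
                rw [hs, mul_add]; linarith [mul_nonneg hτ.le hnn]
              calc tauN N * (∫ u in (uM1 N)..1, gR N u) * S = S * (tauN N * ∫ u in (uM1 N)..1, gR N u) := by ring
                _ ≤ S * (tauN N * ∫ u in (1 / 2 : ℝ)..1, gR N u) := mul_le_mul_of_nonneg_left h1 S_posR.le
                _ ≤ _ := hIER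
            have hH : (us.IR : ℝ) ≤ tauN N * mainR N * S := by
              rw [mainR_eq]
              have hs : ∫ u in (uM N)..1, fR N u = (∫ u in (uM N)..(1 / 2 : ℝ), fR N u) + ∫ u in (1 / 2 : ℝ)..1, fR N u :=
                (intervalIntegral.integral_add_adjacent_intervals (ii_fR N huMpos huMhalf)
                  (ii_fR N (by norm_num) (by norm_num))).symm
              have hnn : 0 ≤ ∫ u in (uM N)..(1 / 2 : ℝ), fR N u :=
                intervalIntegral.integral_nonneg huMhalf fun u hu ↦ fR_nonneg N (by linarith [hu.1])
              have h1 : tauN N * (∫ u in (1 / 2 : ℝ)..1, fR N u) ≤ tauN N * ∫ u in (uM N)..1, fR N u := by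
                rw [hs, mul_add]; linarith [mul_nonneg hτ.le hnn]
              calc (us.IR : ℝ) ≤ S * (tauN N * ∫ u in (1 / 2 : ℝ)..1, fR N u) := hIR
                _ ≤ S * (tauN N * ∫ u in (uM N)..1, fR N u) := mul_le_mul_of_nonneg_left h1 S_posR.le
                _ = _ := by ring
            -- assembling `τ ‖B‖ S ≤ UB < LB ≤ τ R S`
            have hBval := norm_Bval_le hN
            have hRval := Rval_ge hN
            have hUB : tauN N * ‖Bval N‖ * S ≤ ((UB0 + (Numerics.cdiv (th * 222) (100 * Mlo) + Numerics.cdiv th (Mlo ^ 2) +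
                tDelta c T ⟨S, cHiS T⟩ Mlo + tb + (tj1 + tj2)) + us.IEB : ℤ) : ℝ) := by
              have e : tauN N * ‖Bval N‖ * S ≤ tauN N * ‖mainB N‖ * S + tauN N * tinyB N * S +
                  tauN N * deltaB N * S + tauN N * bdry N * S + tauN N * Jsum N * S + tauN N * errIntB N * S := by
                have := mul_le_mul_of_nonneg_right (mul_le_mul_of_nonneg_left hBval hτ.le) S_posR.le
                linarith
              have hC' : tauN N * deltaB N * S ≤ tDelta c T ⟨S, cHiS T⟩ Mlo :=
                le_trans (mul_le_mul_of_nonneg_right hdB S_posR.le) hC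
              push_cast at hA hE ⊢
              linarith
            have hLB : ((us.IR - (tDelta c T (MI.ofInt S 1) Mlo + tb + (tj1 + tj2)) - us.IER : ℤ) : ℝ) ≤ tauN N * Rval N * S := by
              have e : tauN N * mainR N * S - tauN N * deltaR N * S - tauN N * bdry N * S - tauN N * Jsum N * S -
                  tauN N * errIntR N * S ≤ tauN N * Rval N * S := by
                have := mul_le_mul_of_nonneg_right (mul_le_mul_of_nonneg_left hRval hτ.le) S_posR.le
                linarith
              have hC' : tauN N * deltaR N * S ≤ tDelta c T (MI.ofInt S 1) Mlo := by
                refine le_trans (mul_le_mul_of_nonneg_right ?_ S_posR.le) hCR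
                simpa using hdR
              push_cast at hE ⊢
              linarith
            have hUL' : (((UB0 + (Numerics.cdiv (th * 222) (100 * Mlo) + Numerics.cdiv th (Mlo ^ 2) +
                tDelta c T ⟨S, cHiS T⟩ Mlo + tb + (tj1 + tj2)) + us.IEB : ℤ) : ℝ)) <
                ((us.IR - (tDelta c T (MI.ofInt S 1) Mlo + tb + (tj1 + tj2)) - us.IER : ℤ) : ℝ) := by
              exact_mod_cast hUL
            have hτS : 0 < tauN N * S := mul_pos hτ S_posR
            constructor
            · have h1 : tauN N * ‖Bval N‖ * S < tauN N * Rval N * S := lt_of_le_of_lt hUB (lt_of_lt_of_le hUL' hLB)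
              have h2 : (tauN N * S) * ‖Bval N‖ < (tauN N * S) * Rval N := by linarith
              exact lt_of_mul_lt_mul_left h2 hτS.le
            · intro p hp
              have hsb := side_bound hN hp
              have hside' : (((Numerics.cdiv ((th + Numerics.cdiv (29 * (S : ℤ)) 8) * 2) (Mlo + 1) : ℤ) : ℝ)) <
                  ((us.IR - (tDelta c T (MI.ofInt S 1) Mlo + tb + (tj1 + tj2)) - us.IER : ℤ) : ℝ) := by
                exact_mod_cast hside
              have hX : (29 : ℝ) / 8 * S ≤ ((Numerics.cdiv (29 * (S : ℤ)) 8 : ℤ) : ℝ) := by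
                refine le_cdiv_of_le_div (by norm_num) ?_; push_cast; exact le_of_eq (by ring)
              have hs : 2 * (tauN N + shiftX / 2) / (M + 1) * S ≤
                  ((Numerics.cdiv ((th + Numerics.cdiv (29 * (S : ℤ)) 8) * 2) (Mlo + 1) : ℤ) : ℝ) := by
                refine le_cdiv_of_le_div (by exact_mod_cast (show (0 : ℤ) < Mlo + 1 by omega)) ?_
                push_cast
                rw [le_div_iff₀ (by positivity)]
                have hsx : shiftX = 29 / 4 := rfl
                calc 2 * (tauN N + shiftX / 2) / (M + 1) * S * ((Mlo : ℝ) + 1)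
                    = 2 * (tauN N * S + 29 / 8 * S) * ((Mlo + 1) / (M + 1)) := by rw [hsx]; field_simp; ring
                  _ ≤ 2 * (th + ((Numerics.cdiv (29 * (S : ℤ)) 8 : ℤ) : ℝ)) * 1 := by
                      refine mul_le_mul (by linarith) ((div_le_one (by positivity)).2 (by linarith)) (by positivity) ?_
                      have : (0 : ℝ) ≤ ((Numerics.cdiv (29 * (S : ℤ)) 8 : ℤ) : ℝ) := le_trans (by positivity) hX
                      positivity
                  _ = _ := by ring
              have h1 : tauN N * (2 * (‖powSum (sN N) (N / p)‖ / p)) * S ≤ 2 * (tauN N + shiftX / 2) / (M + 1) * S := by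
                have : tauN N * (2 * (‖powSum (sN N) (N / p)‖ / p)) = 2 * (tauN N * (‖powSum (sN N) (N / p)‖ / p)) := by ring
                rw [this]
                exact mul_le_mul_of_nonneg_right hsb S_posR.le
              have h2 : tauN N * (2 * (‖powSum (sN N) (N / p)‖ / p)) * S < tauN N * Rval N * S := by linarith
              have h3 : (tauN N * S) * (2 * (‖powSum (sN N) (N / p)‖ / p)) < (tauN N * S) * Rval N := by linarith
              exact lt_of_mul_lt_mul_left h3 hτS.le
          · simp at hscal
        · simp at hdata
      · simp at hdata
    · rw [if_neg hok] at hdata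
      simp at hdata
  · simp at hc

end Final

end Cert

end TuranShift

end Literature.Barriers.RiemannHypothesis
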